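import Literature.Probability.RandomPlanarGeometry.SAWTriangularPolygonJoinCap
import Literature.Probability.RandomPlanarGeometry.SAWTriangularPolygonJoinMerge
import HarnessLib
import Literature.Probability.RandomPlanarGeometry.SAWTriangularPolygonJoinSlide

/-!
# Madras' polygon join on the triangular lattice — the construction (S4𝕋): caps in position, mirrored types, the join map, the decoder

Merged edition (a-p4 g11, 2026-08-23; ed.2: the two local tactic abbreviations `site_omega`/`site_lin` of JoinMap/JoinDecoder written out in place
with minimal `simp only` sets, no other change) of the four HOME modules `SAWTriangularPolygonJoinAssemble` (ed.2) ⊕ `SAWTriangularPolygonJoinMirror` (ed.2) ⊕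
`SAWTriangularPolygonJoinMap` (ed.2) ⊕ `SAWTriangularPolygonJoinDecoder` (ed.3) of the LINE «TRI-MADRAS» (a-p4 g10), bodies VERBATIM and in this order
(their four module docstrings follow as section headers); imports = the tree modules `SAWTriangularPolygonJoinCap` (cap table),
`SAWTriangularPolygonJoinMerge` (join loop) and `SAWTriangularPolygonJoinSlide` (first contact).  One file instead of four so that the
filing chain JoinCap/JoinMerge/JoinSlide → THIS → JoinFinal has one olean wait instead of four.

Consumer (LINE «TRI-MADRAS»): `SAWTriangularPolygonJoinFinal.lean` (with `…JoinInjective`, `…JoinCount`, `…LoopEdges`) turns this construction into the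
headline `triPolygonNumber_le_rpow_half : ∃ A, ∀ N ≥ 1, q_N(𝕋) ≤ A·N^{−1/2}·μ(𝕋)^N`.  ed.3 (a-p4 g14) = tree ed.2 14370199bbe10c92 + this paragraph (no code change).

Editions: ed.1 44b11ed28eab7aa2 (a-p4 g10/g11 draft with `local macro` tactic abbreviations — never filed), ed.2 14370199bbe10c92 (the merged edition above,
p37xxxx 2026-08-23), ed.3 1eaa90bc4737b83a (consumer note), ed.4 (a-p4 g14) = ed.3 + this editions line (no code change; docstring-only editions refresh the
module's build on the mirror, OPS R13).
-/

/-!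
# Madras' join on `𝕋`: transport of the cap rules, the rotated right polygon, the joined walk (types A, B, C)

Topic `Literature/Probability/RandomPlanarGeometry` (lane «pcv-sawmu», LINE «TRI-MADRAS», step S4𝕋 (b); continues
`SAWTriangularPolygonJoinCap.lean` (`TriCap.capA` at the origin with `CorrA`, `capA_isPolygon_card`, `ne_edges_capA`,
`new_vert_capA`, `vertsOf_capA_subset`, `capA_injective`) and `SAWTriangularPolygonJoinMerge.lean` (`exists_join_loop`)).

Source.  A. Hammond, arXiv:1504.05286 [Hammond2015SAPJoining], §4.1 pp. 17–20 (arXiv v5): Madras' procedure — modify the left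
polygon near the contact site `Y`, "Rotate `σ'` about the vertex `Y` by `π` radians … Form [its modification] according to the same
rules … rotate back", translate the modified right polygon by `T₂`, and merge across the junction plaquette (Definition 4.3);
N. Madras, J. Stat. Phys. 78 (1995) [Madras1995LatticeAnimalsExponent], §2.  Here: the triangular lattice (brick frame), contact
of TYPE A (a site `t` common to both polygons, the left polygon weakly left of the right one in every row — the corridor fact of
`SAWTriangularPolygonJoinSlide.lean` — and strictly so within the five rows around `t`... precisely: the hypotheses `hPt`, `hQt` below),
`T₂ = 6`, joined length `2(N+4)`.

## What is proved (namespace `…SAW.TriJoin`)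

* `IsPolygon.image_brickHom` (images of brick polygons under injective graph endomorphisms), translations `trEdges`, the point
  reflection `ptEdges c` (`z ↦ c − z`), with their `vertsOf`/`card` lemmas;
* `capAt t E := trEdges t (capA (trEdges (−t) E))`, `capAtQ t E := trEdges (6,0) (ptEdges (2t) (capAt t (ptEdges (2t) E)))`;
* **`exists_join_loop_typeA`**: for brick `N`-gons `P ∋ t`, `Q ∋ t` with the type-A facts, a closing walk `ρ ∈ loops (2(N+4) − 1)`
  with the row-separated equal-split cut at `0` whose left half reads `capAt t P − p` and right half `capAtQ t Q − p`,
  `p = t + (2,0)`.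
-/

noncomputable section

open Finset SimpleGraph Literature.Probability.LatticeModels Literature.Probability.Percolation
open Literature.Probability.Percolation.SiteGadgetSystem (vertsOf mem_vertsOf)
open Literature.Barriers.CriticalPhenomena.SupercriticalSAW (shiftEdges mem_shiftEdges_iff card_shiftEdges)

namespace Literature.Probability.RandomPlanarGeometry.SAW

namespace TriJoin

variable {E P Q : Finset (Sym2 (Site 2))} {t c : Site 2}

/-- coordinates of a literal site. [folklore] -/
@[simp] private theorem vec2_zero (a b : ℤ) : (![a, b] : Site 2) 0 = a := rfl
/-- coordinates of a literal site. [folklore] -/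
@[simp] private theorem vec2_one (a b : ℤ) : (![a, b] : Site 2) 1 = b := rfl
/-- two sites are equal iff their coordinates are. [folklore] -/
private theorem site_eq_iffA (x y : Site 2) : x = y ↔ x 0 = y 0 ∧ x 1 = y 1 :=
  ⟨fun h => by rw [h]; exact ⟨rfl, rfl⟩, fun h => by funext i; fin_cases i <;> simp [h.1, h.2]⟩

/-! ### Images of brick polygons under lattice automorphisms -/

/-- The image of a polygon under an injective graph endomorphism is a polygon. [cite: MadrasSlade1993, §3.2, Definition 3.2.1 (p. 62: a polygon as an edge set; transported along an injective graph map)] -/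
theorem IsPolygon.image_hom {V : Type*} [DecidableEq V] {G : SimpleGraph V} {F : Finset (Sym2 V)}
    (φ : G →g G) (hφ : Function.Injective φ) (hF : IsPolygon G F) :
    IsPolygon G (F.image (Sym2.map φ)) := by
  classical
  obtain ⟨u, w, hw, rfl⟩ := hF
  refine ⟨_, w.map φ, hw.map hφ, ?_⟩
  rw [Walk.edges_map]
  ext e
  simp only [List.mem_toFinset, List.mem_map, Finset.mem_image]

/-- translation by `c` as a graph endomorphism of the brick-wall graph. [cite: Grimmett2018, §5.5 (translations of 𝕋)] -/
def trHom (c : Site 2) : brickGraph →g brickGraph where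
  toFun := fun v => v + c
  map_rel' := fun {u w} h => (brickGraph_adj_add_right u w c).2 h

/-- the point reflection `z ↦ c − z` as a graph endomorphism of the brick-wall graph (the lattice's π-rotation about `c/2`).
[cite: Hammond2015SAPJoining, §4.1 p. 18 (arXiv v5: "Rotate `σ'` about the vertex `Y` by `π` radians")] -/
def ptHom (c : Site 2) : brickGraph →g brickGraph where
  toFun := fun v => c - v
  map_rel' := fun {u w} h => by
    have h' := (brickGraph_adj_iff _ _).1 h
    rw [brickGraph_adj_iff]
    simp only [Pi.sub_apply]
    omega

/-- `trHom` is injective. [folklore] -/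
private theorem trHom_injective (c : Site 2) : Function.Injective (trHom c) := fun _ _ h => add_right_cancel h
/-- `ptHom` is injective. [folklore] -/
private theorem ptHom_injective (c : Site 2) : Function.Injective (ptHom c) := fun _ _ h => sub_right_injective h

/-- point-reflected edge set `{c − z : z ∈ e}`. [cite: Hammond2015SAPJoining, §4.1 p. 18 (arXiv v5)] -/
def ptEdges (c : Site 2) (E : Finset (Sym2 (Site 2))) : Finset (Sym2 (Site 2)) := E.image (Sym2.map fun v => c - v)

/-- `shiftEdges` is the image under `trHom`. [folklore] -/
private theorem shiftEdges_eq_image (c : Site 2) (E : Finset (Sym2 (Site 2))) :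
    shiftEdges c E = E.image (Sym2.map (trHom c)) := rfl
/-- `ptEdges` is the image under `ptHom`. [folklore] -/
private theorem ptEdges_eq_image (c : Site 2) (E : Finset (Sym2 (Site 2))) :
    ptEdges c E = E.image (Sym2.map (ptHom c)) := rfl

/-- a translate of a brick polygon is a brick polygon. [cite: Grimmett2018, §5.5] -/
theorem isPolygon_shiftEdges_brick (hE : IsPolygon brickGraph E) (c : Site 2) : IsPolygon brickGraph (shiftEdges c E) := by
  rw [shiftEdges_eq_image]; exact IsPolygon.image_hom _ (trHom_injective c) hE

/-- the point reflection of a brick polygon is a brick polygon. [cite: Hammond2015SAPJoining, §4.1 p. 18 (arXiv v5)] -/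
theorem isPolygon_ptEdges (hE : IsPolygon brickGraph E) (c : Site 2) : IsPolygon brickGraph (ptEdges c E) := by
  rw [ptEdges_eq_image]; exact IsPolygon.image_hom _ (ptHom_injective c) hE

/-- membership in `ptEdges`. [cite: Hammond2015SAPJoining, §4.1 (arXiv v5 p. 18: "Rotate σ′ about the vertex Y by π radians" — the point reflection of an edge set)] -/
theorem mem_ptEdges_iff {e : Sym2 (Site 2)} : e ∈ ptEdges c E ↔ ∃ e' ∈ E, Sym2.map (fun v => c - v) e' = e := by
  rw [ptEdges, Finset.mem_image]

/-- `ptEdges c` is an involution. [cite: Hammond2015SAPJoining, §4.1 (arXiv v5 p. 18: "Rotate σ′ about the vertex Y by π radians" — the point reflection of an edge set)] -/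
theorem ptEdges_ptEdges (c : Site 2) (E : Finset (Sym2 (Site 2))) : ptEdges c (ptEdges c E) = E := by
  rw [ptEdges, ptEdges, Finset.image_image]
  have hcomp : (Sym2.map fun v : Site 2 => c - v) ∘ (Sym2.map fun v : Site 2 => c - v) = id := by
    funext e
    rw [Function.comp_apply, Sym2.map_map]
    have : ((fun v : Site 2 => c - v) ∘ fun v : Site 2 => c - v) = id := by funext v; simp
    rw [this, Sym2.map_id, id]
  rw [hcomp, Finset.image_id]

/-- a concrete edge in `ptEdges`. [cite: Hammond2015SAPJoining, §4.1 (arXiv v5 p. 18: "Rotate σ′ about the vertex Y by π radians" — the point reflection of an edge set)] -/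
theorem mk_mem_ptEdges_iff {a b : Site 2} : s(a, b) ∈ ptEdges c E ↔ s(c - a, c - b) ∈ E := by
  constructor
  · intro h
    have : s(c - a, c - b) ∈ ptEdges c (ptEdges c E) :=
      mem_ptEdges_iff.2 ⟨s(a, b), h, by simp⟩
    rwa [ptEdges_ptEdges] at this
  · intro h
    exact mem_ptEdges_iff.2 ⟨_, h, by simp [sub_sub_cancel]⟩

/-- a concrete edge in `shiftEdges`. [cite: Hammond2015SAPJoining, §3.4 (arXiv v5 p. 12: "Translate φ′ …" — the translate of an edge set)] -/
theorem mk_mem_shiftEdges_iff {a b : Site 2} : s(a, b) ∈ shiftEdges c E ↔ s(a - c, b - c) ∈ E := by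
  constructor
  · intro h
    obtain ⟨e', he', hmap⟩ := mem_shiftEdges_iff.1 h
    induction e' using Sym2.ind with
    | _ x y =>
      simp only [Sym2.map_mk, Sym2.eq_iff] at hmap
      rcases hmap with ⟨rfl, rfl⟩ | ⟨rfl, rfl⟩
      · simpa using he'
      · rw [Sym2.eq_swap]; simpa using he'
  · intro h
    exact mem_shiftEdges_iff.2 ⟨_, h, by simp [sub_add_cancel]⟩

/-- vertices of `ptEdges`. [cite: Hammond2015SAPJoining, §4.1 (arXiv v5 p. 18: "Rotate σ′ about the vertex Y by π radians" — the point reflection of an edge set)] -/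
theorem mem_vertsOf_ptEdges {v : Site 2} : v ∈ vertsOf (ptEdges c E) ↔ c - v ∈ vertsOf E := by
  simp only [mem_vertsOf, mem_ptEdges_iff]
  constructor
  · rintro ⟨e, ⟨e', he', rfl⟩, hv⟩
    refine ⟨e', he', ?_⟩
    obtain ⟨y, hy, rfl⟩ := Sym2.mem_map.1 hv
    simpa using hy
  · rintro ⟨e', he', hv⟩
    exact ⟨_, ⟨e', he', rfl⟩, Sym2.mem_map.2 ⟨c - v, hv, by simp⟩⟩

/-- `ptEdges` preserves the number of edges. [cite: Hammond2015SAPJoining, §4.1 (arXiv v5 p. 18: "Rotate σ′ about the vertex Y by π radians" — the point reflection of an edge set)] -/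
theorem card_ptEdges (c : Site 2) (E : Finset (Sym2 (Site 2))) : (ptEdges c E).card = E.card := by
  rw [ptEdges_eq_image]
  exact Finset.card_image_of_injective _ (Sym2.map.injective (ptHom_injective c))

/-! ### Type A: the two capped polygons in position -/

/-- **The capped LEFT polygon** (type A, contact site `t`): translate `t` to the origin, apply `capA`, translate back.
[cite: Hammond2015SAPJoining, §4.1 p. 18 (arXiv v5: the modified polygon `τ_mod`)] -/
def capAt (t : Site 2) (E : Finset (Sym2 (Site 2))) : Finset (Sym2 (Site 2)) :=
  shiftEdges t (TriCap.capA (shiftEdges (-t) E))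

/-- **The capped RIGHT polygon** (type A, shared contact site `t`, `T₂ = 6`): rotate by `π` about `t`, cap as a left polygon,
rotate back, translate by `(6,0)`. [cite: Hammond2015SAPJoining, §4.1 p. 18 (arXiv v5: "Rotate `σ'` about the vertex `Y` by `π`
radians … rotate back … Translate … to the right by `T₂` units")] -/
def capAtQ (t : Site 2) (E : Finset (Sym2 (Site 2))) : Finset (Sym2 (Site 2)) :=
  shiftEdges ![6, 0] (ptEdges (t + t) (capAt t (ptEdges (t + t) E)))

/-- vertices of `shiftEdges (−t) E`. [folklore] -/
private theorem mem_vertsOf_shift_neg {v : Site 2} : v ∈ vertsOf (shiftEdges (-t) E) ↔ v + t ∈ vertsOf E := by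
  rw [mem_vertsOf_shiftEdges, sub_neg_eq_add]

/-- `CorrA` for the left polygon moved to the origin. [cite: Hammond2015SAPJoining, §4.1 p. 18 (arXiv v5: the empty right corridor)] -/
theorem corrA_left (hPA : ∀ v ∈ vertsOf P, -2 ≤ v 1 - t 1 → v 1 - t 1 ≤ 2 → v 0 ≤ t 0) :
    TriCap.CorrA (shiftEdges (-t) P) := by
  intro v hv h1 h2
  rw [mem_vertsOf_shift_neg] at hv
  have := hPA _ hv (by simp; omega) (by simp; omega)
  simp at this; omega

/-- `CorrA` for the rotated right polygon moved to the origin. [cite: Hammond2015SAPJoining, §4.1 p. 18 (arXiv v5: the empty left corridor)] -/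
theorem corrA_right (hQA : ∀ v ∈ vertsOf Q, -2 ≤ v 1 - t 1 → v 1 - t 1 ≤ 2 → t 0 ≤ v 0) :
    TriCap.CorrA (shiftEdges (-t) (ptEdges (t + t) Q)) := by
  intro v hv h1 h2
  rw [mem_vertsOf_shift_neg, mem_vertsOf_ptEdges] at hv
  have := hQA _ hv (by simp; omega) (by simp; omega)
  simp at this; omega

/-- `![0,0]` is the zero site. [folklore] -/
private theorem vec_zero_eq : (![0, 0] : Site 2) = 0 := by funext i; fin_cases i <;> rfl

/-- `(2,0) + (1,1) = (3,1)`. [folklore] -/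
private theorem vec_20_11 : (![2, 0] : Site 2) + ![1, 1] = ![3, 1] := by funext i; fin_cases i <;> rfl

/-- the origin is a vertex of the moved left polygon. [cite: Hammond2015SAPJoining, §4.1 p. 18 (arXiv v5)] -/
theorem zero_mem_left (ht : t ∈ vertsOf P) : (![0, 0] : Site 2) ∈ vertsOf (shiftEdges (-t) P) := by
  rw [mem_vertsOf_shift_neg, vec_zero_eq, zero_add]; exact ht

/-- the origin is a vertex of the moved rotated right polygon. [cite: Hammond2015SAPJoining, §4.1 p. 18 (arXiv v5)] -/
theorem zero_mem_right (ht : t ∈ vertsOf Q) : (![0, 0] : Site 2) ∈ vertsOf (shiftEdges (-t) (ptEdges (t + t) Q)) := by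
  rw [mem_vertsOf_shift_neg, mem_vertsOf_ptEdges, vec_zero_eq, zero_add, add_sub_cancel_right]; exact ht

/-- **Type A, left polygon: `capAt t P` is a brick polygon with `#P + 4` edges containing the junction edge
`(t+(2,0)) – (t+(3,1))`, and its vertices are vertices of `P` or new sites `t + α`, `α ∈` rows `−1..1`, `1 ≤ α₀`, `α₀ − α₁ ≤ 2`.**
[cite: Hammond2015SAPJoining, §4.1 p. 18 (arXiv v5); Madras1995LatticeAnimalsExponent, §2] -/
theorem capAt_spec (hP : IsPolygon brickGraph P) (ht : t ∈ vertsOf P)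
    (hPA : ∀ v ∈ vertsOf P, -2 ≤ v 1 - t 1 → v 1 - t 1 ≤ 2 → v 0 ≤ t 0) :
    IsPolygon brickGraph (capAt t P) ∧ (capAt t P).card = P.card + 4 ∧
      s(t + ![2, 0], t + ![2, 0] + ![1, 1]) ∈ capAt t P ∧
      (∀ a ∈ vertsOf (capAt t P), a ∈ vertsOf P ∨
        (-1 ≤ a 1 - t 1 ∧ a 1 - t 1 ≤ 1 ∧ 1 ≤ a 0 - t 0 ∧ (a 0 - t 0) - (a 1 - t 1) ≤ 2)) := by
  have hC := corrA_left hPA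
  have h0 := zero_mem_left ht
  have hP' := isPolygon_shiftEdges_brick hP (-t)
  obtain ⟨hpoly, hcard⟩ := TriCap.capA_isPolygon_card hP' hC h0
  refine ⟨isPolygon_shiftEdges_brick hpoly t, ?_, ?_, ?_⟩
  · rw [capAt, card_shiftEdges, hcard, card_shiftEdges]
  · rw [capAt, mk_mem_shiftEdges_iff, add_assoc, add_sub_cancel_left, add_sub_cancel_left, vec_20_11]
    exact (TriCap.ne_edges_capA (shiftEdges (-t) P)).1
  · intro a ha
    rw [capAt, mem_vertsOf_shiftEdges] at ha
    rcases TriCap.vertsOf_capA_subset hP' hC h0 ha with h | h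
    · left; rwa [mem_vertsOf_shift_neg, sub_add_cancel] at h
    · right
      have := TriCap.new_vert_capA hP' hC h0 ha (TriCap.newA_not_vert' hC h)
      simp only [Pi.sub_apply] at this
      exact this

/-- `(1,−1) + (1,1) = (2,0)`. [folklore] -/
private theorem vec_1m1_11 : (![1, -1] : Site 2) + ![1, 1] = ![2, 0] := by funext i; fin_cases i <;> rfl

/-- the type-A facts for the π-rotated right polygon. [cite: Hammond2015SAPJoining, §4.1 p. 18 (arXiv v5)] -/
theorem rotated_facts (hQA : ∀ v ∈ vertsOf Q, -2 ≤ v 1 - t 1 → v 1 - t 1 ≤ 2 → t 0 ≤ v 0) :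
    ∀ v ∈ vertsOf (ptEdges (t + t) Q), -2 ≤ v 1 - t 1 → v 1 - t 1 ≤ 2 → v 0 ≤ t 0 := by
  intro v hv h1 h2
  rw [mem_vertsOf_ptEdges] at hv
  have := hQA _ hv (by simp; omega) (by simp; omega)
  simp at this; omega

/-- **Type A, right polygon: `capAtQ t Q` is a brick polygon with `#Q + 4` edges containing the junction edge
`(t+(4,0)) – (t+(5,1))`; its vertices are translates by `(6,0)` of vertices of `Q`, or new sites `b` with
`β := t − b + (6,0)` in rows `−1..1`, `1 ≤ β₀`, `β₀ − β₁ ≤ 2`.** [cite: Hammond2015SAPJoining, §4.1 p. 18 (arXiv v5); Madras1995LatticeAnimalsExponent, §2] -/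
theorem capAtQ_spec (hQ : IsPolygon brickGraph Q) (ht : t ∈ vertsOf Q)
    (hQA : ∀ v ∈ vertsOf Q, -2 ≤ v 1 - t 1 → v 1 - t 1 ≤ 2 → t 0 ≤ v 0) :
    IsPolygon brickGraph (capAtQ t Q) ∧ (capAtQ t Q).card = Q.card + 4 ∧
      s(t + ![4, 0], t + ![5, 1]) ∈ capAtQ t Q ∧
      (∀ b ∈ vertsOf (capAtQ t Q), b - ![6, 0] ∈ vertsOf Q ∨
        (-1 ≤ t 1 - b 1 ∧ t 1 - b 1 ≤ 1 ∧ 1 ≤ t 0 - b 0 + 6 ∧ (t 0 - b 0 + 6) - (t 1 - b 1) ≤ 2)) := by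
  set Q₁ := ptEdges (t + t) Q with hQ₁
  have hQ₁poly : IsPolygon brickGraph Q₁ := isPolygon_ptEdges hQ (t + t)
  have ht₁ : t ∈ vertsOf Q₁ := by rw [hQ₁, mem_vertsOf_ptEdges, add_sub_cancel_right]; exact ht
  have hfacts := rotated_facts (Q := Q) hQA
  have hC := corrA_left (P := Q₁) hfacts
  have h0 := zero_mem_left ht₁
  have hQ₁' := isPolygon_shiftEdges_brick hQ₁poly (-t)
  obtain ⟨hpoly, hcard, -, hverts⟩ := capAt_spec hQ₁poly ht₁ hfacts
  refine ⟨?_, ?_, ?_, ?_⟩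
  · exact isPolygon_shiftEdges_brick (isPolygon_ptEdges hpoly _) _
  · rw [capAtQ, card_shiftEdges, card_ptEdges, ← hQ₁, hcard, hQ₁, card_ptEdges]
  · -- the lower NE-edge `(t+(1,−1)) – (t+(2,0))` of `capAt t Q₁`, rotated and shifted
    have hlow : s(t + ![1, -1], t + ![2, 0]) ∈ capAt t Q₁ := by
      rw [capAt, mk_mem_shiftEdges_iff, add_sub_cancel_left, add_sub_cancel_left]
      exact (TriCap.ne_edges_capA (shiftEdges (-t) Q₁)).2
    rw [capAtQ, mk_mem_shiftEdges_iff, mk_mem_ptEdges_iff, ← hQ₁, Sym2.eq_swap]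
    have k1 : t + t - (t + ![4, 0] - ![6, 0]) = t + ![2, 0] := by
      rw [show t + t - (t + ![4, 0] - ![6, 0]) = t + (![6, 0] - ![4, 0]) by abel]
      congr 1; funext i; fin_cases i <;> rfl
    have k2 : t + t - (t + ![5, 1] - ![6, 0]) = t + ![1, -1] := by
      rw [show t + t - (t + ![5, 1] - ![6, 0]) = t + (![6, 0] - ![5, 1]) by abel]
      congr 1; funext i; fin_cases i <;> rfl
    rw [k1, k2]; exact hlow
  · intro b hb
    rw [capAtQ, mem_vertsOf_shiftEdges, mem_vertsOf_ptEdges, ← hQ₁] at hb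
    rcases hverts _ hb with h | h
    · left; rwa [hQ₁, mem_vertsOf_ptEdges, sub_sub_cancel] at h
    · right
      simp only [Pi.add_apply, Pi.sub_apply, Matrix.cons_val_zero, Matrix.cons_val_one] at h
      omega

/-- **Type A: the joined walk.**  For brick `N`-gons `P` (left) and `Q` (right) sharing the contact site `t`, with the
type-A corridor facts (within two rows of `t`, `P` is weakly left of `t` and `Q` weakly right of it) and `P` weakly left of
`Q` in every row, Madras' join (cap both at `t`, the right one through the π-rotation, shift it by `T₂ = 6`, merge across the
rhombus at `p = t + (2,0)`) is a closing walk `ρ ∈ loops (2(N+4) − 1)` with a row-separated equal-split cut at `0`, whose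
halves read the two capped polygons. [cite: Hammond2015SAPJoining, Definition 4.3 p. 20 (arXiv v5: `J(τ,σ) ∈ SAP_{n+m+16}` on
`ℤ²`; here `2N + 8` on `𝕋`); Madras1995LatticeAnimalsExponent, §2] -/
theorem exists_join_loop_typeA {N : ℕ} (hP : IsPolygon brickGraph P) (hQ : IsPolygon brickGraph Q)
    (hPN : P.card = N) (hQN : Q.card = N) (htP : t ∈ vertsOf P) (htQ : t ∈ vertsOf Q)
    (hPA : ∀ v ∈ vertsOf P, -2 ≤ v 1 - t 1 → v 1 - t 1 ≤ 2 → v 0 ≤ t 0)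
    (hQA : ∀ v ∈ vertsOf Q, -2 ≤ v 1 - t 1 → v 1 - t 1 ≤ 2 → t 0 ≤ v 0)
    (hsep : ∀ a ∈ vertsOf P, ∀ b ∈ vertsOf Q, a 1 = b 1 → a 0 ≤ b 0) :
    ∃ ρ : ℕ → Site 2, ((capAt t P).card = N + 4 ∧ (capAtQ t Q).card = N + 4 ∧
      s(t + ![2, 0], t + ![2, 0] + ![1, 1]) ∈ capAt t P ∧ s(t + ![2, 0] + ![2, 0], t + ![2, 0] + ![3, 1]) ∈ capAtQ t Q) ∧
      ρ ∈ TriPolygon.loops (2 * (N + 4) - 1) ∧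
      ρ 0 = 0 ∧ ρ (N + 4 - 1) = ![1, 1] ∧ ρ (N + 4) = ![3, 1] ∧ ρ (2 * (N + 4) - 1) = ![2, 0] ∧
      (∀ i, i < N + 4 → ρ i + (t + ![2, 0]) ∈ vertsOf (capAt t P)) ∧
      (∀ i, N + 4 ≤ i → i ≤ 2 * (N + 4) - 1 → ρ i + (t + ![2, 0]) ∈ vertsOf (capAtQ t Q)) ∧
      (∀ x ∈ vertsOf (capAt t P), ∃ i, i < N + 4 ∧ ρ i + (t + ![2, 0]) = x) ∧
      (∀ x ∈ vertsOf (capAtQ t Q), ∃ i, N + 4 ≤ i ∧ i ≤ 2 * (N + 4) - 1 ∧ ρ i + (t + ![2, 0]) = x) ∧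
      (∀ i, i + 1 < N + 4 → s(ρ i + (t + ![2, 0]), ρ (i + 1) + (t + ![2, 0])) ∈ capAt t P) ∧
      (∀ i, N + 4 ≤ i → i + 1 ≤ 2 * (N + 4) - 1 → s(ρ i + (t + ![2, 0]), ρ (i + 1) + (t + ![2, 0])) ∈ capAtQ t Q) ∧
      (∀ a b : ℕ, a < N + 4 → N + 4 ≤ b → b < 2 * (N + 4) → ρ a 1 = ρ b 1 → ρ a 0 < ρ b 0) := by
  obtain ⟨hPp, hPc, hPe, hPv⟩ := capAt_spec hP htP hPA
  obtain ⟨hQp, hQc, hQe, hQv⟩ := capAtQ_spec hQ htQ hQA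
  have he₂ : s(t + ![2, 0] + ![2, 0], t + ![2, 0] + ![3, 1]) ∈ capAtQ t Q := by
    have k1 : t + ![2, 0] + ![2, 0] = t + ![4, 0] := by
      rw [add_assoc]; congr 1; funext i; fin_cases i <;> rfl
    have k2 : t + ![2, 0] + ![3, 1] = t + ![5, 1] := by
      rw [add_assoc]; congr 1; funext i; fin_cases i <;> rfl
    rw [k1, k2]; exact hQe
  have hsep' : ∀ a ∈ vertsOf (capAt t P), ∀ b ∈ vertsOf (capAtQ t Q), a 1 = b 1 → a 0 < b 0 := by
    intro a ha b hb hrow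
    rcases hPv a ha with ha' | ha' <;> rcases hQv b hb with hb' | hb'
    · have := hsep a ha' _ hb' (by simp; omega)
      simp at this; omega
    · have := hPA a ha' (by omega) (by omega)
      omega
    · have := hQA _ hb' (by simp; omega) (by simp; omega)
      simp at this; omega
    · omega
  obtain ⟨ρ, hρ⟩ := TriPolygon.exists_join_loop hPp hQp (by rw [hPc, hPN]) (by rw [hQc, hQN]) hPe he₂ hsep'
  exact ⟨ρ, ⟨by rw [hPc, hPN], by rw [hQc, hQN], hPe, he₂⟩, hρ⟩

/-! ### Type B: a column contact (`t = o + (0,1) ∈ P`, `w = o − (0,1) ∈ Q`, centre `o`) -/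

/-- **The capped LEFT polygon, type B** (frame origin = the centre `o`). [cite: Hammond2015SAPJoining, §4.1 p. 18 (arXiv v5)] -/
def capBt (o : Site 2) (E : Finset (Sym2 (Site 2))) : Finset (Sym2 (Site 2)) :=
  shiftEdges o (TriCap.capB (shiftEdges (-o) E))

/-- **The capped RIGHT polygon, type B** (`T₂ = 4`): rotate by `π` about the centre `o`, cap, rotate back, shift by `(4,0)`.
[cite: Hammond2015SAPJoining, §4.1 p. 18 (arXiv v5)] -/
def capBtQ (o : Site 2) (E : Finset (Sym2 (Site 2))) : Finset (Sym2 (Site 2)) :=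
  shiftEdges ![4, 0] (ptEdges (o + o) (capBt o (ptEdges (o + o) E)))

variable {o : Site 2}

/-- vertices of `shiftEdges (−o) E`. [folklore] -/
private theorem mem_vertsOf_shift_neg' {v : Site 2} : v ∈ vertsOf (shiftEdges (-o) E) ↔ v + o ∈ vertsOf E := by
  rw [mem_vertsOf_shiftEdges, sub_neg_eq_add]

/-- The type-B facts for a left polygon `E` at centre `o`: corridor rows `o₁−3 … o₁+1` have `X ≤ o₀`, and the three sites
`o + (0,−1)`, `o + (−1,0)`, `o + (−1,−2)` are not vertices (no shared site, no diagonal contact pair).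
[cite: Hammond2015SAPJoining, §4.1 p. 18 (arXiv v5)] -/
def FactsB (o : Site 2) (E : Finset (Sym2 (Site 2))) : Prop :=
  (∀ v ∈ vertsOf E, -3 ≤ v 1 - o 1 → v 1 - o 1 ≤ 1 → v 0 ≤ o 0) ∧
    o + ![0, -1] ∉ vertsOf E ∧ o + ![-1, 0] ∉ vertsOf E ∧ o + ![-1, -2] ∉ vertsOf E

/-- `CorrB` for the left polygon moved to the origin. [cite: Hammond2015SAPJoining, §4.1 p. 18 (arXiv v5)] -/
theorem corrB_left (h : FactsB o P) : TriCap.CorrB (shiftEdges (-o) P) := by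
  obtain ⟨hrow, h1, h2, h3⟩ := h
  refine ⟨?_, ?_, ?_, ?_⟩
  · intro v hv ha hb
    rw [mem_vertsOf_shift_neg'] at hv
    have := hrow _ hv (by simp; omega) (by simp; omega)
    simp at this; omega
  · rw [mem_vertsOf_shift_neg', add_comm]; exact h1
  · rw [mem_vertsOf_shift_neg', add_comm]; exact h2
  · rw [mem_vertsOf_shift_neg', add_comm]; exact h3

/-- The type-B facts for the π-rotated right polygon: from the right polygon's own facts (corridor rows `o₁−1 … o₁+3` have
`X ≥ o₀`; `o + (0,1)`, `o + (1,0)`, `o + (1,2)` are not vertices). [cite: Hammond2015SAPJoining, §4.1 p. 18 (arXiv v5)] -/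
theorem factsB_rot (hrow : ∀ v ∈ vertsOf Q, -1 ≤ v 1 - o 1 → v 1 - o 1 ≤ 3 → o 0 ≤ v 0)
    (h1 : o + ![0, 1] ∉ vertsOf Q) (h2 : o + ![1, 0] ∉ vertsOf Q) (h3 : o + ![1, 2] ∉ vertsOf Q) :
    FactsB o (ptEdges (o + o) Q) := by
  refine ⟨?_, ?_, ?_, ?_⟩
  · intro v hv ha hb
    rw [mem_vertsOf_ptEdges] at hv
    have := hrow _ hv (by simp; omega) (by simp; omega)
    simp at this; omega
  · rw [mem_vertsOf_ptEdges]; convert h1 using 2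
    rw [show o + o - (o + ![0, -1]) = o + (-![0, -1]) by abel]; congr 1; funext i; fin_cases i <;> rfl
  · rw [mem_vertsOf_ptEdges]; convert h2 using 2
    rw [show o + o - (o + ![-1, 0]) = o + (-![-1, 0]) by abel]; congr 1; funext i; fin_cases i <;> rfl
  · rw [mem_vertsOf_ptEdges]; convert h3 using 2
    rw [show o + o - (o + ![-1, -2]) = o + (-![-1, -2]) by abel]; congr 1; funext i; fin_cases i <;> rfl

/-- `(1,0)+(1,1) = (2,1)`, `(0,−1)+(1,1) = (1,0)`. [folklore] -/
private theorem vec_10_11 : (![1, 0] : Site 2) + ![1, 1] = ![2, 1] := by funext i; fin_cases i <;> rfl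

/-- **Type B, left polygon: `capBt o P` is a brick polygon with `#P + 4` edges containing the junction edge
`(o+(1,0)) – (o+(2,1))`; its vertices are old or `o + α` with `α` in rows `−1..1`, `−1 ≤ α₀`, `α₀ − α₁ ≤ 1`.**
[cite: Hammond2015SAPJoining, §4.1 p. 18 (arXiv v5); Madras1995LatticeAnimalsExponent, §2] -/
theorem capBt_spec (hP : IsPolygon brickGraph P) (ht : o + ![0, 1] ∈ vertsOf P) (hF : FactsB o P) :
    IsPolygon brickGraph (capBt o P) ∧ (capBt o P).card = P.card + 4 ∧
      s(o + ![1, 0], o + ![1, 0] + ![1, 1]) ∈ capBt o P ∧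
      (∀ a ∈ vertsOf (capBt o P), a ∈ vertsOf P ∨
        (-1 ≤ a 1 - o 1 ∧ a 1 - o 1 ≤ 1 ∧ -1 ≤ a 0 - o 0 ∧ (a 0 - o 0) - (a 1 - o 1) ≤ 1)) := by
  have hC := corrB_left hF
  have h0 : (![0, 1] : Site 2) ∈ vertsOf (shiftEdges (-o) P) := by rw [mem_vertsOf_shift_neg', add_comm]; exact ht
  have hP' := isPolygon_shiftEdges_brick hP (-o)
  obtain ⟨hpoly, hcard⟩ := TriCap.capB_isPolygon_card hP' hC h0
  refine ⟨isPolygon_shiftEdges_brick hpoly o, ?_, ?_, ?_⟩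
  · rw [capBt, card_shiftEdges, hcard, card_shiftEdges]
  · rw [capBt, mk_mem_shiftEdges_iff, add_assoc, add_sub_cancel_left, add_sub_cancel_left, vec_10_11]
    exact (TriCap.ne_edges_capB (shiftEdges (-o) P)).1
  · intro a ha
    rw [capBt, mem_vertsOf_shiftEdges] at ha
    rcases TriCap.vertsOf_capB_subset hP' hC h0 ha with h | h
    · left; rwa [mem_vertsOf_shift_neg', sub_add_cancel] at h
    · right
      have := TriCap.new_vert_capB hP' hC h0 ha (TriCap.newB_not_vert' hC h)
      simp only [Pi.sub_apply] at this
      exact this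

/-- **Type B, right polygon: `capBtQ o Q` is a brick polygon with `#Q + 4` edges containing the junction edge
`(o+(3,0)) – (o+(4,1))`; vertices: old shifted by `(4,0)`, or new `b` with `β := o − b + (4,0)` in rows `−1..1`, `−1 ≤ β₀`,
`β₀ − β₁ ≤ 1`.** [cite: Hammond2015SAPJoining, §4.1 p. 18 (arXiv v5); Madras1995LatticeAnimalsExponent, §2] -/
theorem capBtQ_spec (hQ : IsPolygon brickGraph Q) (hw : o + ![0, -1] ∈ vertsOf Q)
    (hrow : ∀ v ∈ vertsOf Q, -1 ≤ v 1 - o 1 → v 1 - o 1 ≤ 3 → o 0 ≤ v 0)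
    (h1 : o + ![0, 1] ∉ vertsOf Q) (h2 : o + ![1, 0] ∉ vertsOf Q) (h3 : o + ![1, 2] ∉ vertsOf Q) :
    IsPolygon brickGraph (capBtQ o Q) ∧ (capBtQ o Q).card = Q.card + 4 ∧
      s(o + ![3, 0], o + ![4, 1]) ∈ capBtQ o Q ∧
      (∀ b ∈ vertsOf (capBtQ o Q), b - ![4, 0] ∈ vertsOf Q ∨
        (-1 ≤ o 1 - b 1 ∧ o 1 - b 1 ≤ 1 ∧ -1 ≤ o 0 - b 0 + 4 ∧ (o 0 - b 0 + 4) - (o 1 - b 1) ≤ 1)) := by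
  set Q₁ := ptEdges (o + o) Q with hQ₁
  have hQ₁poly : IsPolygon brickGraph Q₁ := isPolygon_ptEdges hQ (o + o)
  have ht₁ : o + ![0, 1] ∈ vertsOf Q₁ := by
    rw [hQ₁, mem_vertsOf_ptEdges]; convert hw using 2
    rw [show o + o - (o + ![0, 1]) = o + (-![0, 1]) by abel]; congr 1; funext i; fin_cases i <;> rfl
  have hF := factsB_rot (Q := Q) hrow h1 h2 h3
  obtain ⟨hpoly, hcard, -, hverts⟩ := capBt_spec hQ₁poly ht₁ hF
  refine ⟨?_, ?_, ?_, ?_⟩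
  · exact isPolygon_shiftEdges_brick (isPolygon_ptEdges hpoly _) _
  · rw [capBtQ, card_shiftEdges, card_ptEdges, ← hQ₁, hcard, hQ₁, card_ptEdges]
  · have hC := corrB_left hF
    have hlow : s(o + ![0, -1], o + ![1, 0]) ∈ capBt o Q₁ := by
      rw [capBt, mk_mem_shiftEdges_iff, add_sub_cancel_left, add_sub_cancel_left]
      exact (TriCap.ne_edges_capB (shiftEdges (-o) Q₁)).2
    rw [capBtQ, mk_mem_shiftEdges_iff, mk_mem_ptEdges_iff, ← hQ₁, Sym2.eq_swap]
    have k1 : o + o - (o + ![3, 0] - ![4, 0]) = o + ![1, 0] := by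
      rw [show o + o - (o + ![3, 0] - ![4, 0]) = o + (![4, 0] - ![3, 0]) by abel]
      congr 1; funext i; fin_cases i <;> rfl
    have k2 : o + o - (o + ![4, 1] - ![4, 0]) = o + ![0, -1] := by
      rw [show o + o - (o + ![4, 1] - ![4, 0]) = o + (![4, 0] - ![4, 1]) by abel]
      congr 1; funext i; fin_cases i <;> rfl
    rw [k1, k2]; exact hlow
  · intro b hb
    rw [capBtQ, mem_vertsOf_shiftEdges, mem_vertsOf_ptEdges, ← hQ₁] at hb
    rcases hverts _ hb with h | h
    · left; rwa [hQ₁, mem_vertsOf_ptEdges, sub_sub_cancel] at h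
    · right
      simp only [Pi.add_apply, Pi.sub_apply, Matrix.cons_val_zero, Matrix.cons_val_one] at h
      omega

/-- **Type B: the joined walk** (`T₂ = 4`, junction at `p = o + (1,0)`). [cite: Hammond2015SAPJoining, Definition 4.3 p. 20 (arXiv v5); Madras1995LatticeAnimalsExponent, §2] -/
theorem exists_join_loop_typeB {N : ℕ} (hP : IsPolygon brickGraph P) (hQ : IsPolygon brickGraph Q)
    (hPN : P.card = N) (hQN : Q.card = N) (htP : o + ![0, 1] ∈ vertsOf P) (hwQ : o + ![0, -1] ∈ vertsOf Q)
    (hFP : FactsB o P)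
    (hrowQ : ∀ v ∈ vertsOf Q, -1 ≤ v 1 - o 1 → v 1 - o 1 ≤ 3 → o 0 ≤ v 0)
    (hQ1 : o + ![0, 1] ∉ vertsOf Q) (hQ2 : o + ![1, 0] ∉ vertsOf Q) (hQ3 : o + ![1, 2] ∉ vertsOf Q)
    (hsep : ∀ a ∈ vertsOf P, ∀ b ∈ vertsOf Q, a 1 = b 1 → a 0 ≤ b 0) :
    ∃ ρ : ℕ → Site 2, ((capBt o P).card = N + 4 ∧ (capBtQ o Q).card = N + 4 ∧
      s(o + ![1, 0], o + ![1, 0] + ![1, 1]) ∈ capBt o P ∧ s(o + ![1, 0] + ![2, 0], o + ![1, 0] + ![3, 1]) ∈ capBtQ o Q) ∧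
      ρ ∈ TriPolygon.loops (2 * (N + 4) - 1) ∧
      ρ 0 = 0 ∧ ρ (N + 4 - 1) = ![1, 1] ∧ ρ (N + 4) = ![3, 1] ∧ ρ (2 * (N + 4) - 1) = ![2, 0] ∧
      (∀ i, i < N + 4 → ρ i + (o + ![1, 0]) ∈ vertsOf (capBt o P)) ∧
      (∀ i, N + 4 ≤ i → i ≤ 2 * (N + 4) - 1 → ρ i + (o + ![1, 0]) ∈ vertsOf (capBtQ o Q)) ∧
      (∀ x ∈ vertsOf (capBt o P), ∃ i, i < N + 4 ∧ ρ i + (o + ![1, 0]) = x) ∧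
      (∀ x ∈ vertsOf (capBtQ o Q), ∃ i, N + 4 ≤ i ∧ i ≤ 2 * (N + 4) - 1 ∧ ρ i + (o + ![1, 0]) = x) ∧
      (∀ i, i + 1 < N + 4 → s(ρ i + (o + ![1, 0]), ρ (i + 1) + (o + ![1, 0])) ∈ capBt o P) ∧
      (∀ i, N + 4 ≤ i → i + 1 ≤ 2 * (N + 4) - 1 → s(ρ i + (o + ![1, 0]), ρ (i + 1) + (o + ![1, 0])) ∈ capBtQ o Q) ∧
      (∀ a b : ℕ, a < N + 4 → N + 4 ≤ b → b < 2 * (N + 4) → ρ a 1 = ρ b 1 → ρ a 0 < ρ b 0) := by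
  obtain ⟨hPp, hPc, hPe, hPv⟩ := capBt_spec hP htP hFP
  obtain ⟨hQp, hQc, hQe, hQv⟩ := capBtQ_spec hQ hwQ hrowQ hQ1 hQ2 hQ3
  have he₂ : s(o + ![1, 0] + ![2, 0], o + ![1, 0] + ![3, 1]) ∈ capBtQ o Q := by
    have k1 : o + ![1, 0] + ![2, 0] = o + ![3, 0] := by
      rw [add_assoc]; congr 1; funext i; fin_cases i <;> rfl
    have k2 : o + ![1, 0] + ![3, 1] = o + ![4, 1] := by
      rw [add_assoc]; congr 1; funext i; fin_cases i <;> rfl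
    rw [k1, k2]; exact hQe
  have hsep' : ∀ a ∈ vertsOf (capBt o P), ∀ b ∈ vertsOf (capBtQ o Q), a 1 = b 1 → a 0 < b 0 := by
    intro a ha b hb hrow
    obtain ⟨hrowP, -, -, -⟩ := hFP
    rcases hPv a ha with ha' | ha' <;> rcases hQv b hb with hb' | hb'
    · have := hsep a ha' _ hb' (by simp; omega)
      simp at this; omega
    · have := hrowP a ha' (by omega) (by omega)
      omega
    · have := hrowQ _ hb' (by simp; omega) (by simp; omega)
      simp at this; omega
    · omega
  obtain ⟨ρ, hρ⟩ := TriPolygon.exists_join_loop hPp hQp (by rw [hPc, hPN]) (by rw [hQc, hQN]) hPe he₂ hsep'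
  exact ⟨ρ, ⟨by rw [hPc, hPN], by rw [hQc, hQN], hPe, he₂⟩, hρ⟩

/-! ### Type C: a diagonal contact (`t ∈ P`, `w = t + (1,−1) ∈ Q`) -/

/-- **The capped LEFT polygon, type C** (frame origin `t`). [cite: Hammond2015SAPJoining, §4.1 p. 18 (arXiv v5)] -/
def capCt (t : Site 2) (E : Finset (Sym2 (Site 2))) : Finset (Sym2 (Site 2)) :=
  shiftEdges t (TriCap.capC (shiftEdges (-t) E))

/-- the junction site of the left polygon (`t + (1,−1)` or `t + (3,−1)`). [cite: Hammond2015SAPJoining, §4.1 p. 18 (arXiv v5)] -/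
def juncCt (t : Site 2) (E : Finset (Sym2 (Site 2))) : Site 2 := t + TriCap.juncC (shiftEdges (-t) E)

/-- the shift `T₂ ∈ {4, 6, 8}` of type C, from the two junction sites. [cite: Hammond2015SAPJoining, §4.1 p. 18 (arXiv v5: `T₂` "five … six … seven" on `ℤ²`)] -/
def shiftC (t : Site 2) (P Q : Finset (Sym2 (Site 2))) : ℤ :=
  TriCap.juncC (shiftEdges (-t) P) 0 + TriCap.juncC (shiftEdges (-t) (ptEdges (t + t + ![1, -1]) Q)) 0 + 2

/-- **The capped RIGHT polygon, type C**: rotate by `π` about the pair's centre (`z ↦ t + w − z`, `w = t + (1,−1)`), cap in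
the left frame at `t`, rotate back, shift by `T₂ = shiftC`. [cite: Hammond2015SAPJoining, §4.1 p. 18 (arXiv v5)] -/
def capCtQ (t : Site 2) (P Q : Finset (Sym2 (Site 2))) : Finset (Sym2 (Site 2)) :=
  shiftEdges ![shiftC t P Q, 0] (ptEdges (t + t + ![1, -1]) (capCt t (ptEdges (t + t + ![1, -1]) Q)))

/-- The type-C facts for a left polygon `E` at the contact site `t`: corridor rows `t₁−3 … t₁+1` have `X ≤ t₀ + 1`, and
`t + (1,−1)` is not a vertex. [cite: Hammond2015SAPJoining, §4.1 p. 18 (arXiv v5)] -/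
def FactsC (t : Site 2) (E : Finset (Sym2 (Site 2))) : Prop :=
  (∀ v ∈ vertsOf E, -3 ≤ v 1 - t 1 → v 1 - t 1 ≤ 1 → v 0 ≤ t 0 + 1) ∧ t + ![1, -1] ∉ vertsOf E

/-- `CorrC` for the left polygon moved to the origin. [cite: Hammond2015SAPJoining, §4.1 p. 18 (arXiv v5)] -/
theorem corrC_left (h : FactsC t P) : TriCap.CorrC (shiftEdges (-t) P) := by
  obtain ⟨hrow, h1⟩ := h
  refine ⟨?_, ?_⟩
  · intro v hv ha hb
    rw [mem_vertsOf_shift_neg] at hv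
    have := hrow _ hv (by simp; omega) (by simp; omega)
    simp at this; omega
  · rw [mem_vertsOf_shift_neg, add_comm]; exact h1

/-- The type-C facts for the π-rotated right polygon, from the right polygon's facts (rows `t₁−2 … t₁+2` have `X ≥ t₀`, and
`t ∉ Q`). [cite: Hammond2015SAPJoining, §4.1 p. 18 (arXiv v5)] -/
theorem factsC_rot (hrow : ∀ v ∈ vertsOf Q, -2 ≤ v 1 - t 1 → v 1 - t 1 ≤ 2 → t 0 ≤ v 0) (h1 : t ∉ vertsOf Q) :
    FactsC t (ptEdges (t + t + ![1, -1]) Q) := by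
  refine ⟨?_, ?_⟩
  · intro v hv ha hb
    rw [mem_vertsOf_ptEdges] at hv
    have := hrow _ hv (by simp only [Pi.add_apply, Pi.sub_apply, vec2_one]; omega)
      (by simp only [Pi.add_apply, Pi.sub_apply, vec2_one]; omega)
    simp only [Pi.add_apply, Pi.sub_apply, vec2_zero] at this; omega
  · rw [mem_vertsOf_ptEdges]
    rw [show t + t + ![1, -1] - (t + ![1, -1]) = t by abel]; exact h1

/-- the junction site is `t + (1,−1)` or `t + (3,−1)`. [cite: Hammond2015SAPJoining, §4.1 p. 18 (arXiv v5)] -/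
theorem juncC_cases (E : Finset (Sym2 (Site 2))) :
    TriCap.juncC E = ![1, -1] ∨ TriCap.juncC E = ![3, -1] := by
  classical
  unfold TriCap.juncC; split_ifs
  · exact Or.inr rfl
  · exact Or.inl rfl

/-- **Type C, left polygon: `capCt t P` is a brick polygon with `#P + 4` edges containing the junction edge at `juncCt t P`;
its vertices are old or `t + α`, `α` in rows `−1..1`, `1 ≤ α₀`, `α₀ − α₁ ≤ juncC₀ + 1`.**
[cite: Hammond2015SAPJoining, §4.1 p. 18 (arXiv v5); Madras1995LatticeAnimalsExponent, §2] -/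
theorem capCt_spec (hP : IsPolygon brickGraph P) (ht : t ∈ vertsOf P) (hF : FactsC t P) :
    IsPolygon brickGraph (capCt t P) ∧ (capCt t P).card = P.card + 4 ∧
      s(juncCt t P, juncCt t P + ![1, 1]) ∈ capCt t P ∧
      (∀ a ∈ vertsOf (capCt t P), a ∈ vertsOf P ∨
        (-1 ≤ a 1 - t 1 ∧ a 1 - t 1 ≤ 1 ∧ 1 ≤ a 0 - t 0 ∧
          (a 0 - t 0) - (a 1 - t 1) ≤ TriCap.juncC (shiftEdges (-t) P) 0 + 1)) := by
  have hC := corrC_left hF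
  have h0 := zero_mem_left ht
  have hP' := isPolygon_shiftEdges_brick hP (-t)
  obtain ⟨hpoly, hcard⟩ := TriCap.capC_isPolygon_card hP' hC h0
  refine ⟨isPolygon_shiftEdges_brick hpoly t, ?_, ?_, ?_⟩
  · rw [capCt, card_shiftEdges, hcard, card_shiftEdges]
  · rw [capCt, juncCt, mk_mem_shiftEdges_iff, add_assoc, add_sub_cancel_left, add_sub_cancel_left]
    exact TriCap.ne_edge_capC (shiftEdges (-t) P)
  · intro a ha
    rw [capCt, mem_vertsOf_shiftEdges] at ha
    by_cases hold : a - t ∈ vertsOf (shiftEdges (-t) P)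
    · left; rwa [mem_vertsOf_shift_neg, sub_add_cancel] at hold
    · right
      have := TriCap.new_vert_capC hP' hC h0 ha hold
      have hj := juncC_cases (shiftEdges (-t) P)
      simp only [Pi.sub_apply] at this
      rcases hj with hj | hj <;> rw [hj] at this ⊢ <;> simp at this ⊢ <;> omega

/-- **Type C: the joined walk** (`T₂ = shiftC t P Q ∈ {4,6,8}`, junction at `p = juncCt t P`).  Hypotheses: the type-C facts
for `P` at `t` and for `Q` (rows `t₁−2 … t₁+2` have `X ≥ t₀`, `t ∉ Q`, `w = t + (1,−1) ∈ Q`), and `P` strictly left of `Q` in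
every row (no shared site).  [cite: Hammond2015SAPJoining, Definition 4.3 p. 20 (arXiv v5); Madras1995LatticeAnimalsExponent, §2] -/
theorem exists_join_loop_typeC {N : ℕ} (hP : IsPolygon brickGraph P) (hQ : IsPolygon brickGraph Q)
    (hPN : P.card = N) (hQN : Q.card = N) (htP : t ∈ vertsOf P) (hwQ : t + ![1, -1] ∈ vertsOf Q)
    (hFP : FactsC t P)
    (hrowQ : ∀ v ∈ vertsOf Q, -2 ≤ v 1 - t 1 → v 1 - t 1 ≤ 2 → t 0 ≤ v 0) (htQ : t ∉ vertsOf Q)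
    (hsep : ∀ a ∈ vertsOf P, ∀ b ∈ vertsOf Q, a 1 = b 1 → a 0 < b 0) :
    ∃ ρ : ℕ → Site 2, ((capCt t P).card = N + 4 ∧ (capCtQ t P Q).card = N + 4 ∧
      s(juncCt t P, juncCt t P + ![1, 1]) ∈ capCt t P ∧ s(juncCt t P + ![2, 0], juncCt t P + ![3, 1]) ∈ capCtQ t P Q) ∧
      ρ ∈ TriPolygon.loops (2 * (N + 4) - 1) ∧
      ρ 0 = 0 ∧ ρ (N + 4 - 1) = ![1, 1] ∧ ρ (N + 4) = ![3, 1] ∧ ρ (2 * (N + 4) - 1) = ![2, 0] ∧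
      (∀ i, i < N + 4 → ρ i + juncCt t P ∈ vertsOf (capCt t P)) ∧
      (∀ i, N + 4 ≤ i → i ≤ 2 * (N + 4) - 1 → ρ i + juncCt t P ∈ vertsOf (capCtQ t P Q)) ∧
      (∀ x ∈ vertsOf (capCt t P), ∃ i, i < N + 4 ∧ ρ i + juncCt t P = x) ∧
      (∀ x ∈ vertsOf (capCtQ t P Q), ∃ i, N + 4 ≤ i ∧ i ≤ 2 * (N + 4) - 1 ∧ ρ i + juncCt t P = x) ∧
      (∀ i, i + 1 < N + 4 → s(ρ i + juncCt t P, ρ (i + 1) + juncCt t P) ∈ capCt t P) ∧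
      (∀ i, N + 4 ≤ i → i + 1 ≤ 2 * (N + 4) - 1 → s(ρ i + juncCt t P, ρ (i + 1) + juncCt t P) ∈ capCtQ t P Q) ∧
      (∀ a b : ℕ, a < N + 4 → N + 4 ≤ b → b < 2 * (N + 4) → ρ a 1 = ρ b 1 → ρ a 0 < ρ b 0) := by
  obtain ⟨hPp, hPc, hPe, hPv⟩ := capCt_spec hP htP hFP
  -- the rotated right polygon
  set c := t + t + ![1, -1] with hc
  set Q₁ := ptEdges c Q with hQ₁
  have hQ₁poly : IsPolygon brickGraph Q₁ := isPolygon_ptEdges hQ c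
  have ht₁ : t ∈ vertsOf Q₁ := by
    rw [hQ₁, mem_vertsOf_ptEdges, hc, show t + t + ![1, -1] - t = t + ![1, -1] by abel]; exact hwQ
  have hF₁ : FactsC t Q₁ := factsC_rot hrowQ htQ
  obtain ⟨hQ₁p, hQ₁c, hQ₁e, hQ₁v⟩ := capCt_spec hQ₁poly ht₁ hF₁
  -- junction sites and the shift
  set jP := TriCap.juncC (shiftEdges (-t) P) with hjP
  set jQ := TriCap.juncC (shiftEdges (-t) Q₁) with hjQ
  have hT : shiftC t P Q = jP 0 + jQ 0 + 2 := by rw [shiftC, ← hc, ← hQ₁]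
  have hjP01 : (jP 0 = 1 ∨ jP 0 = 3) ∧ jP 1 = -1 := by
    rcases juncC_cases (shiftEdges (-t) P) with h | h <;> rw [← hjP] at h <;> rw [h] <;> simp
  have hjQ01 : (jQ 0 = 1 ∨ jQ 0 = 3) ∧ jQ 1 = -1 := by
    rcases juncC_cases (shiftEdges (-t) Q₁) with h | h <;> rw [← hjQ] at h <;> rw [h] <;> simp
  have hp : juncCt t P = t + jP := rfl
  -- the right capped polygon and its junction edge
  have hQp : IsPolygon brickGraph (capCtQ t P Q) := by
    rw [capCtQ, ← hc, ← hQ₁]; exact isPolygon_shiftEdges_brick (isPolygon_ptEdges hQ₁p _) _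
  have hQc : (capCtQ t P Q).card = N + 4 := by
    rw [capCtQ, ← hc, ← hQ₁, card_shiftEdges, card_ptEdges, hQ₁c, hQ₁, card_ptEdges, hQN]
  have c0 : c 0 = t 0 + t 0 + 1 := by rw [hc]; simp only [Pi.add_apply, vec2_zero]
  have c1 : c 1 = t 1 + t 1 + (-1) := by rw [hc]; simp only [Pi.add_apply, vec2_one]
  have he₂ : s(juncCt t P + ![2, 0], juncCt t P + ![3, 1]) ∈ capCtQ t P Q := by
    rw [capCtQ, ← hc, ← hQ₁, hT, mk_mem_shiftEdges_iff, mk_mem_ptEdges_iff, Sym2.eq_swap, hp]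
    have k1 : c - (t + jP + ![3, 1] - ![jP 0 + jQ 0 + 2, 0]) = t + jQ := by
      rw [site_eq_iffA]
      simp only [Pi.sub_apply, Pi.add_apply, vec2_zero, vec2_one, c0, c1, hjP01.2, hjQ01.2]
      constructor <;> ring
    have k2 : c - (t + jP + ![2, 0] - ![jP 0 + jQ 0 + 2, 0]) = t + jQ + ![1, 1] := by
      rw [site_eq_iffA]
      simp only [Pi.sub_apply, Pi.add_apply, vec2_zero, vec2_one, c0, c1, hjP01.2, hjQ01.2]
      constructor <;> ring
    rw [k1, k2]; exact hQ₁e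
  -- vertices of the right capped polygon
  have hQv : ∀ b ∈ vertsOf (capCtQ t P Q), b - ![jP 0 + jQ 0 + 2, 0] ∈ vertsOf Q ∨
      (-1 ≤ (c - (b - ![jP 0 + jQ 0 + 2, 0])) 1 - t 1 ∧ (c - (b - ![jP 0 + jQ 0 + 2, 0])) 1 - t 1 ≤ 1 ∧
        1 ≤ (c - (b - ![jP 0 + jQ 0 + 2, 0])) 0 - t 0 ∧
        ((c - (b - ![jP 0 + jQ 0 + 2, 0])) 0 - t 0) - ((c - (b - ![jP 0 + jQ 0 + 2, 0])) 1 - t 1) ≤ jQ 0 + 1) := by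
    intro b hb
    rw [capCtQ, ← hc, ← hQ₁, hT, mem_vertsOf_shiftEdges, mem_vertsOf_ptEdges] at hb
    rcases hQ₁v _ hb with h | h
    · left; rwa [hQ₁, mem_vertsOf_ptEdges, sub_sub_cancel] at h
    · right; exact h
  have hsep' : ∀ a ∈ vertsOf (capCt t P), ∀ b ∈ vertsOf (capCtQ t P Q), a 1 = b 1 → a 0 < b 0 := by
    intro a ha b hb hrow
    obtain ⟨hrowP, -⟩ := hFP
    obtain ⟨hjP0, -⟩ := hjP01
    obtain ⟨hjQ0, -⟩ := hjQ01
    rcases hPv a ha with ha' | ha' <;> rcases hQv b hb with hb' | hb'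
    · have := hsep a ha' _ hb' (by simp only [Pi.sub_apply, vec2_one]; omega)
      simp only [Pi.sub_apply, vec2_zero] at this; omega
    · simp only [Pi.sub_apply, vec2_zero, vec2_one, c0, c1] at hb'
      have := hrowP a ha' (by omega) (by omega)
      omega
    · have := hrowQ _ hb' (by simp only [Pi.sub_apply, vec2_one]; omega) (by simp only [Pi.sub_apply, vec2_one]; omega)
      simp only [Pi.sub_apply, vec2_zero] at this; omega
    · simp only [Pi.sub_apply, vec2_zero, vec2_one, c0, c1] at hb'
      omega
  obtain ⟨ρ, hρ⟩ := TriPolygon.exists_join_loop hPp hQp (by rw [hPc, hPN]) hQc hPe he₂ hsep'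
  exact ⟨ρ, ⟨by rw [hPc, hPN], hQc, hPe, he₂⟩, hρ⟩

end TriJoin

end Literature.Probability.RandomPlanarGeometry.SAW

/-!
# Madras' join on `𝕋`: the packaged join loop and the two mirrored contact types (by `Y ↦ −Y` conjugation)

Topic `Literature/Probability/RandomPlanarGeometry` (lane «pcv-sawmu», LINE «TRI-MADRAS», step S4𝕋 (a′); continues
`SAWTriangularPolygonJoinAssemble.lean` (`exists_join_loop_typeA/B/C`)).

Source.  A. Hammond, arXiv:1504.05286 [Hammond2015SAPJoining], §4.1 pp. 17–20 (arXiv v5): Madras' joining procedure on `ℤ²`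
selects "the vertex `z` with the maximal `y`-coordinate" among the contact vertices and modifies both polygons near it; N. Madras,
J. Stat. Phys. 78 (1995) 681–699 [Madras1995LatticeAnimalsExponent], §2.  On `𝕋` (brick frame) the lane's selection rule (design note
`HOME/pub-sawmu-a-p4/g10/DESIGN-tri-cap.md` §1, §4c) meets two contact configurations that are the `Y`-mirror images of the ones
constructed in `SAWTriangularPolygonJoinAssemble.lean`: a DIAGONAL pair with the right polygon above-right (`t ∈ P`, `t + (1,1) ∈ Q`),
and a COLUMN pair with the left polygon below (`o − (0,1) ∈ P`, `o + (0,1) ∈ Q`).  They are joined by conjugating the type-C / type-B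
constructions with the lattice automorphism `flipY : (X,Y) ↦ (X,−Y)` (`SAWTriangularPolygonSupermult.lean`), which preserves
left/right and maps the junction rhombus `{p, p+(1,1), p+(3,1), p+(2,0)}` to `{p, p+(1,−1), p+(3,−1), p+(2,0)}` — still an
`IsRowSepCut` of `SAWTriangularPolygonJoinDecode.lean` (`u − p ∈ {(±1,±1)}`), with the orientation legible from `ρ (M−1) = (1,−1)`.

## Contents (namespace `Literature.Probability.RandomPlanarGeometry.SAW.TriJoin`)
* `JoinLoop M u w j FP FQ ρ` — the packaged conclusion of the join constructions (`ρ ∈ loops (2M−1)`, junction values, the two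
  halves are the vertex/edge sets of `FP`, `FQ` translated by `−j`, strict row separation); `exists_joinLoop_typeA/B/C` (repackaged);
* `fyHom`, `fyEdges` (+ `isPolygon_fyEdges`, `mk_mem_fyEdges_iff`, `mem_vertsOf_fyEdges`, `fyEdges_fyEdges`, `card_fyEdges`),
  `flipW_mem_loops`, **`JoinLoop.flip`** (conjugation of a join loop by `flipY`);
* `FactsB'`, `FactsC'` and **`exists_joinLoop_typeB'`**, **`exists_joinLoop_typeC'`** — the mirrored contact types.
-/

open Finset SimpleGraph Literature.Probability.LatticeModels Literature.Probability.Percolation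
open Literature.Barriers.CriticalPhenomena.SupercriticalSAW (shiftEdges mem_shiftEdges_iff card_shiftEdges)
open Literature.Probability.Percolation.SiteGadgetSystem (vertsOf mem_vertsOf)

namespace Literature.Probability.RandomPlanarGeometry.SAW

namespace TriJoin

open TriPolygon (flipY flipW loops mem_loops flipW_mem_brickSaws adj_flipY_iff)

variable {P Q E : Finset (Sym2 (Site 2))} {t o c : Site 2}

/-- coordinates of a literal site. [folklore] -/
@[simp] private theorem vec2_zero' (a b : ℤ) : (![a, b] : Site 2) 0 = a := rfl
/-- coordinates of a literal site. [folklore] -/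
@[simp] private theorem vec2_one' (a b : ℤ) : (![a, b] : Site 2) 1 = b := rfl
/-- two sites are equal iff their coordinates are. [folklore] -/
private theorem site_eq_iff'' (x y : Site 2) : x = y ↔ x 0 = y 0 ∧ x 1 = y 1 :=
  ⟨fun h => by rw [h]; exact ⟨rfl, rfl⟩, fun h => by funext i; fin_cases i <;> simp [h.1, h.2]⟩

/-! ### The packaged join loop -/

/-- **The join loop** of two capped polygons `FP` (left) and `FQ` (right) with junction translation `j`: a closing brick walk
`ρ ∈ loops (2M−1)` from `0` with `ρ (M−1) = u`, `ρ M = w`, `ρ (2M−1) = (2,0)`, whose first `M` sites (translated by `j`) are exactly the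
vertices of `FP` and whose last `M` sites are exactly the vertices of `FQ`, whose consecutive edges lie in `FP` resp. `FQ`, and whose two
halves are strictly row-separated; both capped polygons have `M` edges and contain their junction edges `{j, j+u}`, `{j+(2,0), j+w}`.
[cite: Hammond2015SAPJoining, Definition 4.3 (arXiv v5 p. 20: the Madras join polygon)] -/
def JoinLoop (M : ℕ) (u w j : Site 2) (FP FQ : Finset (Sym2 (Site 2))) (ρ : ℕ → Site 2) : Prop :=
  (FP.card = M ∧ FQ.card = M ∧ s(j, j + u) ∈ FP ∧ s(j + ![2, 0], j + w) ∈ FQ) ∧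
  ρ ∈ loops (2 * M - 1) ∧ ρ 0 = 0 ∧ ρ (M - 1) = u ∧ ρ M = w ∧ ρ (2 * M - 1) = ![2, 0] ∧
  (∀ i, i < M → ρ i + j ∈ vertsOf FP) ∧ (∀ i, M ≤ i → i ≤ 2 * M - 1 → ρ i + j ∈ vertsOf FQ) ∧
  (∀ x ∈ vertsOf FP, ∃ i, i < M ∧ ρ i + j = x) ∧ (∀ x ∈ vertsOf FQ, ∃ i, M ≤ i ∧ i ≤ 2 * M - 1 ∧ ρ i + j = x) ∧
  (∀ i, i + 1 < M → s(ρ i + j, ρ (i + 1) + j) ∈ FP) ∧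
  (∀ i, M ≤ i → i + 1 ≤ 2 * M - 1 → s(ρ i + j, ρ (i + 1) + j) ∈ FQ) ∧
  (∀ a b : ℕ, a < M → M ≤ b → b < 2 * M → ρ a 1 = ρ b 1 → ρ a 0 < ρ b 0)

/-- type A, repackaged. [cite: Hammond2015SAPJoining, §4.1 pp. 17–20 (arXiv v5); Madras1995LatticeAnimalsExponent, §2] -/
theorem exists_joinLoop_typeA {N : ℕ} (hP : IsPolygon brickGraph P) (hQ : IsPolygon brickGraph Q)
    (hPN : P.card = N) (hQN : Q.card = N) (htP : t ∈ vertsOf P) (htQ : t ∈ vertsOf Q)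
    (hPA : ∀ v ∈ vertsOf P, -2 ≤ v 1 - t 1 → v 1 - t 1 ≤ 2 → v 0 ≤ t 0)
    (hQA : ∀ v ∈ vertsOf Q, -2 ≤ v 1 - t 1 → v 1 - t 1 ≤ 2 → t 0 ≤ v 0)
    (hsep : ∀ a ∈ vertsOf P, ∀ b ∈ vertsOf Q, a 1 = b 1 → a 0 ≤ b 0) :
    ∃ ρ, JoinLoop (N + 4) ![1, 1] ![3, 1] (t + ![2, 0]) (capAt t P) (capAtQ t Q) ρ := by
  obtain ⟨ρ, h⟩ := exists_join_loop_typeA hP hQ hPN hQN htP htQ hPA hQA hsep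
  exact ⟨ρ, h⟩

/-- type B, repackaged. [cite: Hammond2015SAPJoining, §4.1 pp. 17–20 (arXiv v5); Madras1995LatticeAnimalsExponent, §2] -/
theorem exists_joinLoop_typeB {N : ℕ} (hP : IsPolygon brickGraph P) (hQ : IsPolygon brickGraph Q)
    (hPN : P.card = N) (hQN : Q.card = N) (htP : o + ![0, 1] ∈ vertsOf P) (hwQ : o + ![0, -1] ∈ vertsOf Q)
    (hFP : FactsB o P)
    (hrowQ : ∀ v ∈ vertsOf Q, -1 ≤ v 1 - o 1 → v 1 - o 1 ≤ 3 → o 0 ≤ v 0)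
    (hQ1 : o + ![0, 1] ∉ vertsOf Q) (hQ2 : o + ![1, 0] ∉ vertsOf Q) (hQ3 : o + ![1, 2] ∉ vertsOf Q)
    (hsep : ∀ a ∈ vertsOf P, ∀ b ∈ vertsOf Q, a 1 = b 1 → a 0 ≤ b 0) :
    ∃ ρ, JoinLoop (N + 4) ![1, 1] ![3, 1] (o + ![1, 0]) (capBt o P) (capBtQ o Q) ρ := by
  obtain ⟨ρ, h⟩ := exists_join_loop_typeB hP hQ hPN hQN htP hwQ hFP hrowQ hQ1 hQ2 hQ3 hsep
  exact ⟨ρ, h⟩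

/-- type C, repackaged. [cite: Hammond2015SAPJoining, §4.1 pp. 17–20 (arXiv v5); Madras1995LatticeAnimalsExponent, §2] -/
theorem exists_joinLoop_typeC {N : ℕ} (hP : IsPolygon brickGraph P) (hQ : IsPolygon brickGraph Q)
    (hPN : P.card = N) (hQN : Q.card = N) (htP : t ∈ vertsOf P) (hwQ : t + ![1, -1] ∈ vertsOf Q)
    (hFP : FactsC t P)
    (hrowQ : ∀ v ∈ vertsOf Q, -2 ≤ v 1 - t 1 → v 1 - t 1 ≤ 2 → t 0 ≤ v 0) (htQ : t ∉ vertsOf Q)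
    (hsep : ∀ a ∈ vertsOf P, ∀ b ∈ vertsOf Q, a 1 = b 1 → a 0 < b 0) :
    ∃ ρ, JoinLoop (N + 4) ![1, 1] ![3, 1] (juncCt t P) (capCt t P) (capCtQ t P Q) ρ := by
  obtain ⟨ρ, h⟩ := exists_join_loop_typeC hP hQ hPN hQN htP hwQ hFP hrowQ htQ hsep
  exact ⟨ρ, h⟩

/-! ### The reflection `Y ↦ −Y` on edge sets -/

/-- `flipY`, coordinates. [folklore] -/
@[simp] private theorem flipY_apply_zero (z : Site 2) : flipY z 0 = z 0 := rfl
/-- `flipY`, coordinates. [folklore] -/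
@[simp] private theorem flipY_apply_one (z : Site 2) : flipY z 1 = -z 1 := rfl
/-- `flipY` is an involution. [folklore] -/
private theorem flipY_flipY' (z : Site 2) : flipY (flipY z) = z := by rw [site_eq_iff'']; simp
/-- `flipY` is additive. [folklore] -/
private theorem flipY_add (a b : Site 2) : flipY (a + b) = flipY a + flipY b := by
  rw [site_eq_iff'']; simp; ring
/-- `flipY 0 = 0`. [folklore] -/
private theorem flipY_zero'' : flipY (0 : Site 2) = 0 := by rw [site_eq_iff'']; simp
/-- `flipY` on a literal. [folklore] -/
private theorem flipY_lit (a b : ℤ) : flipY ![a, b] = ![a, -b] := by rw [site_eq_iff'']; simp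
/-- `flipY` is injective. [folklore] -/
private theorem flipY_injective' : Function.Injective flipY := fun x y h => by
  rw [← flipY_flipY' x, h, flipY_flipY']

/-- `flipY` as a graph endomorphism of the brick-wall graph. [cite: MadrasSlade1993, §3.2 (proof of Theorem 3.2.3: "by symmetry")] -/
def fyHom : brickGraph →g brickGraph where
  toFun := flipY
  map_rel' := fun {u w} h => (adj_flipY_iff u w).2 h

/-- the reflected edge set `{flipY z : z ∈ e}`. [cite: MadrasSlade1993, §3.2 (proof of Theorem 3.2.3: "by symmetry")] -/
def fyEdges (E : Finset (Sym2 (Site 2))) : Finset (Sym2 (Site 2)) := E.image (Sym2.map flipY)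

/-- `fyEdges` is the image under `fyHom`. [folklore] -/
private theorem fyEdges_eq_image (E : Finset (Sym2 (Site 2))) : fyEdges E = E.image (Sym2.map fyHom) := rfl

/-- the reflection of a brick polygon is a brick polygon. [cite: MadrasSlade1993, §3.2 (proof of Theorem 3.2.3: "by symmetry")] -/
theorem isPolygon_fyEdges (hE : IsPolygon brickGraph E) : IsPolygon brickGraph (fyEdges E) := by
  rw [fyEdges_eq_image]; exact IsPolygon.image_hom _ flipY_injective' hE

/-- membership in `fyEdges`. [cite: MadrasSlade1993, §3.2, proof of Theorem 3.2.3 (p. 64: "by symmetry" — the reflected edge set)] -/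
theorem mem_fyEdges_iff {e : Sym2 (Site 2)} : e ∈ fyEdges E ↔ ∃ e' ∈ E, Sym2.map flipY e' = e := by
  rw [fyEdges, Finset.mem_image]

/-- `fyEdges` is an involution. [cite: MadrasSlade1993, §3.2, proof of Theorem 3.2.3 (p. 64: "by symmetry" — the reflected edge set)] -/
theorem fyEdges_fyEdges (E : Finset (Sym2 (Site 2))) : fyEdges (fyEdges E) = E := by
  rw [fyEdges, fyEdges, Finset.image_image]
  have hcomp : (Sym2.map flipY) ∘ (Sym2.map flipY) = id := by
    funext e
    rw [Function.comp_apply, Sym2.map_map]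
    have : (flipY ∘ flipY) = id := by funext v; simp [flipY_flipY']
    rw [this, Sym2.map_id, id]
  rw [hcomp, Finset.image_id]

/-- a concrete edge in `fyEdges`. [cite: MadrasSlade1993, §3.2, proof of Theorem 3.2.3 (p. 64: "by symmetry" — the reflected edge set)] -/
theorem mk_mem_fyEdges_iff {a b : Site 2} : s(a, b) ∈ fyEdges E ↔ s(flipY a, flipY b) ∈ E := by
  constructor
  · intro h
    have : s(flipY a, flipY b) ∈ fyEdges (fyEdges E) := mem_fyEdges_iff.2 ⟨s(a, b), h, by simp⟩
    rwa [fyEdges_fyEdges] at this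
  · intro h
    exact mem_fyEdges_iff.2 ⟨_, h, by simp [flipY_flipY']⟩

/-- vertices of `fyEdges`. [cite: MadrasSlade1993, §3.2, proof of Theorem 3.2.3 (p. 64: "by symmetry" — the reflected edge set)] -/
theorem mem_vertsOf_fyEdges {v : Site 2} : v ∈ vertsOf (fyEdges E) ↔ flipY v ∈ vertsOf E := by
  simp only [mem_vertsOf, mem_fyEdges_iff]
  constructor
  · rintro ⟨e, ⟨e', he', rfl⟩, hv⟩
    refine ⟨e', he', ?_⟩
    obtain ⟨y, hy, rfl⟩ := Sym2.mem_map.1 hv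
    rwa [flipY_flipY']
  · rintro ⟨e', he', hv⟩
    exact ⟨_, ⟨e', he', rfl⟩, Sym2.mem_map.2 ⟨flipY v, hv, flipY_flipY' v⟩⟩

/-- `fyEdges` preserves the number of edges. [cite: MadrasSlade1993, §3.2, proof of Theorem 3.2.3 (p. 64: "by symmetry" — the reflected edge set)] -/
theorem card_fyEdges (E : Finset (Sym2 (Site 2))) : (fyEdges E).card = E.card := by
  rw [fyEdges_eq_image]
  exact Finset.card_image_of_injective _ (Sym2.map.injective flipY_injective')

/-- the reflection of a closing walk is a closing walk. [cite: MadrasSlade1993, §3.2 (proof of Theorem 3.2.3: "by symmetry")] -/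
theorem flipW_mem_loops {n : ℕ} {ρ : ℕ → Site 2} (hρ : ρ ∈ loops n) : flipW ρ ∈ loops n := by
  obtain ⟨hs, hadj⟩ := mem_loops.1 hρ
  refine mem_loops.2 ⟨flipW_mem_brickSaws hs, ?_⟩
  have h := (adj_flipY_iff (ρ n) 0).2 hadj
  rw [flipY_zero''] at h
  exact h

/-- **Conjugating a join loop by `Y ↦ −Y`.** [cite: MadrasSlade1993, §3.2 ("by symmetry"); Hammond2015SAPJoining, §4.1 (arXiv v5 pp. 17–20)] -/
theorem JoinLoop.flip {M : ℕ} {u w j : Site 2} {FP FQ : Finset (Sym2 (Site 2))} {ρ : ℕ → Site 2}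
    (h : JoinLoop M u w j FP FQ ρ) :
    JoinLoop M (flipY u) (flipY w) (flipY j) (fyEdges FP) (fyEdges FQ) (flipW ρ) := by
  obtain ⟨⟨cP, cQ, jP, jQ⟩, hl, h0, hu, hw, hq, vP, vQ, sP, sQ, eP, eQ, sep⟩ := h
  have hfw : ∀ i, flipW ρ i + flipY j = flipY (ρ i + j) := fun i => by rw [flipW, flipY_add]
  refine ⟨⟨?_, ?_, ?_, ?_⟩, flipW_mem_loops hl, ?_, ?_, ?_, ?_, ?_, ?_, ?_, ?_, ?_, ?_, ?_⟩
  · rw [card_fyEdges, cP]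
  · rw [card_fyEdges, cQ]
  · rw [← flipY_add, mk_mem_fyEdges_iff, flipY_flipY', flipY_flipY']; exact jP
  · rw [← flipY_add, show (![2, 0] : Site 2) = flipY ![2, 0] by rw [flipY_lit, neg_zero], ← flipY_add,
      mk_mem_fyEdges_iff, flipY_flipY', flipY_flipY']; exact jQ
  · simp only [flipW, h0, flipY_zero'']
  · simp only [flipW, hu]
  · simp only [flipW, hw]
  · simp only [flipW, hq, flipY_lit, neg_zero]
  · intro i hi; rw [hfw, mem_vertsOf_fyEdges, flipY_flipY']; exact vP i hi
  · intro i hi hi'; rw [hfw, mem_vertsOf_fyEdges, flipY_flipY']; exact vQ i hi hi'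
  · intro x hx
    obtain ⟨i, hi, hix⟩ := sP (flipY x) (mem_vertsOf_fyEdges.1 hx)
    exact ⟨i, hi, by rw [hfw, hix, flipY_flipY']⟩
  · intro x hx
    obtain ⟨i, hi, hi', hix⟩ := sQ (flipY x) (mem_vertsOf_fyEdges.1 hx)
    exact ⟨i, hi, hi', by rw [hfw, hix, flipY_flipY']⟩
  · intro i hi; rw [hfw, hfw, mk_mem_fyEdges_iff, flipY_flipY', flipY_flipY']; exact eP i hi
  · intro i hi hi'; rw [hfw, hfw, mk_mem_fyEdges_iff, flipY_flipY', flipY_flipY']; exact eQ i hi hi'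
  · intro a b ha hb hb' hrow
    simp only [flipW, flipY_apply_one, neg_inj] at hrow
    simp only [flipW, flipY_apply_zero]
    exact sep a b ha hb hb' hrow

/-! ### The mirrored contact types -/

/-- vertices of the reflected polygon, relative coordinates. [folklore] -/
private theorem vertsOf_fy_rel {v : Site 2} (hv : v ∈ vertsOf (fyEdges E)) :
    flipY v ∈ vertsOf E ∧ (flipY v) 0 = v 0 ∧ (flipY v) 1 = -v 1 :=
  ⟨mem_vertsOf_fyEdges.1 hv, rfl, rfl⟩

/-- **Mirrored type-C facts** (diagonal pair `t ∈ P`, `t + (1,1) ∈ Q`): rows `t₁−1 … t₁+3` of `P` have `X ≤ t₀ + 1`, and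
`t + (1,1) ∉ P`. [cite: Hammond2015SAPJoining, §4.1 p. 18 (arXiv v5: the empty right corridor)] -/
def FactsC' (t : Site 2) (E : Finset (Sym2 (Site 2))) : Prop :=
  (∀ v ∈ vertsOf E, -1 ≤ v 1 - t 1 → v 1 - t 1 ≤ 3 → v 0 ≤ t 0 + 1) ∧ t + ![1, 1] ∉ vertsOf E

/-- the mirrored type-C facts are the type-C facts of the reflected polygon. [cite: Hammond2015SAPJoining, §4.1 p. 18 (arXiv v5)] -/
theorem factsC_of_factsC' (h : FactsC' t P) : FactsC (flipY t) (fyEdges P) := by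
  obtain ⟨hrow, h11⟩ := h
  refine ⟨?_, ?_⟩
  · intro v hv ha hb
    have hv' := mem_vertsOf_fyEdges.1 hv
    have := hrow _ hv' (by simp at ha hb ⊢; omega) (by simp at ha hb ⊢; omega)
    simpa using this
  · rw [mem_vertsOf_fyEdges, flipY_add, flipY_flipY', flipY_lit]; exact h11

/-- the hypotheses of type C for the reflected pair, from the mirrored hypotheses. [cite: MadrasSlade1993, §3.2 ("by symmetry")] -/
theorem typeC'_flip (htP : t ∈ vertsOf P) (hwQ : t + ![1, 1] ∈ vertsOf Q) (hFP : FactsC' t P)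
    (hrowQ : ∀ v ∈ vertsOf Q, -2 ≤ v 1 - t 1 → v 1 - t 1 ≤ 2 → t 0 ≤ v 0) (htQ : t ∉ vertsOf Q)
    (hsep : ∀ a ∈ vertsOf P, ∀ b ∈ vertsOf Q, a 1 = b 1 → a 0 < b 0) :
    flipY t ∈ vertsOf (fyEdges P) ∧ flipY t + ![1, -1] ∈ vertsOf (fyEdges Q) ∧ FactsC (flipY t) (fyEdges P) ∧
      (∀ v ∈ vertsOf (fyEdges Q), -2 ≤ v 1 - flipY t 1 → v 1 - flipY t 1 ≤ 2 → flipY t 0 ≤ v 0) ∧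
      flipY t ∉ vertsOf (fyEdges Q) ∧
      (∀ a ∈ vertsOf (fyEdges P), ∀ b ∈ vertsOf (fyEdges Q), a 1 = b 1 → a 0 < b 0) := by
  have htP' : flipY t ∈ vertsOf (fyEdges P) := by rw [mem_vertsOf_fyEdges, flipY_flipY']; exact htP
  have hwQ' : flipY t + ![1, -1] ∈ vertsOf (fyEdges Q) := by
    rw [mem_vertsOf_fyEdges, flipY_add, flipY_flipY', flipY_lit, neg_neg]; exact hwQ
  have hrowQ' : ∀ v ∈ vertsOf (fyEdges Q), -2 ≤ v 1 - flipY t 1 → v 1 - flipY t 1 ≤ 2 → flipY t 0 ≤ v 0 := by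
    intro v hv ha hb
    have hv' := mem_vertsOf_fyEdges.1 hv
    have := hrowQ _ hv' (by simp at ha hb ⊢; omega) (by simp at ha hb ⊢; omega)
    simpa using this
  have htQ' : flipY t ∉ vertsOf (fyEdges Q) := by rw [mem_vertsOf_fyEdges, flipY_flipY']; exact htQ
  have hsep' : ∀ a ∈ vertsOf (fyEdges P), ∀ b ∈ vertsOf (fyEdges Q), a 1 = b 1 → a 0 < b 0 := by
    intro a ha b hb hrow
    have ha' := mem_vertsOf_fyEdges.1 ha
    have hb' := mem_vertsOf_fyEdges.1 hb
    have := hsep _ ha' _ hb' (by simp; exact hrow)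
    simpa using this
  exact ⟨htP', hwQ', factsC_of_factsC' hFP, hrowQ', htQ', hsep'⟩

/-- **The mirrored type C** (right polygon above-right of the diagonal contact): the join loop with junction rhombus
`{p, p+(1,−1), p+(3,−1), p+(2,0)}`, obtained from `exists_joinLoop_typeC` for the reflected pair and reflected back.
[cite: Hammond2015SAPJoining, §4.1 pp. 17–20 (arXiv v5); Madras1995LatticeAnimalsExponent, §2] -/
theorem exists_joinLoop_typeC' {N : ℕ} (hP : IsPolygon brickGraph P) (hQ : IsPolygon brickGraph Q)
    (hPN : P.card = N) (hQN : Q.card = N) (htP : t ∈ vertsOf P) (hwQ : t + ![1, 1] ∈ vertsOf Q)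
    (hFP : FactsC' t P)
    (hrowQ : ∀ v ∈ vertsOf Q, -2 ≤ v 1 - t 1 → v 1 - t 1 ≤ 2 → t 0 ≤ v 0) (htQ : t ∉ vertsOf Q)
    (hsep : ∀ a ∈ vertsOf P, ∀ b ∈ vertsOf Q, a 1 = b 1 → a 0 < b 0) :
    ∃ ρ, JoinLoop (N + 4) ![1, -1] ![3, -1] (flipY (juncCt (flipY t) (fyEdges P)))
      (fyEdges (capCt (flipY t) (fyEdges P))) (fyEdges (capCtQ (flipY t) (fyEdges P) (fyEdges Q))) ρ := by
  have hP' := isPolygon_fyEdges hP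
  have hQ' := isPolygon_fyEdges hQ
  have hPN' : (fyEdges P).card = N := by rw [card_fyEdges, hPN]
  have hQN' : (fyEdges Q).card = N := by rw [card_fyEdges, hQN]
  obtain ⟨htP', hwQ', hF', hrowQ', htQ', hsep'⟩ := typeC'_flip htP hwQ hFP hrowQ htQ hsep
  obtain ⟨ρ, h⟩ := exists_joinLoop_typeC hP' hQ' hPN' hQN' htP' hwQ' hF' hrowQ' htQ' hsep'
  refine ⟨flipW ρ, ?_⟩
  have h' := h.flip
  rw [flipY_lit, flipY_lit] at h'
  exact h'

/-- **Mirrored type-B facts** (column pair with the left polygon BELOW: `o − (0,1) ∈ P`, `o + (0,1) ∈ Q`): rows `o₁−1 … o₁+3` of `P`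
have `X ≤ o₀`, and `o + (0,1)`, `o + (−1,0)`, `o + (−1,2)` are not vertices of `P` (no shared site, no diagonal pair).
[cite: Hammond2015SAPJoining, §4.1 p. 18 (arXiv v5: the empty right corridor)] -/
def FactsB' (o : Site 2) (E : Finset (Sym2 (Site 2))) : Prop :=
  (∀ v ∈ vertsOf E, -1 ≤ v 1 - o 1 → v 1 - o 1 ≤ 3 → v 0 ≤ o 0) ∧
    o + ![0, 1] ∉ vertsOf E ∧ o + ![-1, 0] ∉ vertsOf E ∧ o + ![-1, 2] ∉ vertsOf E

/-- the mirrored type-B facts are the type-B facts of the reflected polygon. [cite: Hammond2015SAPJoining, §4.1 p. 18 (arXiv v5)] -/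
theorem factsB_of_factsB' (h : FactsB' o P) : FactsB (flipY o) (fyEdges P) := by
  obtain ⟨hrow, h1, h2, h3⟩ := h
  refine ⟨?_, ?_, ?_, ?_⟩
  · intro v hv ha hb
    have hv' := mem_vertsOf_fyEdges.1 hv
    have := hrow _ hv' (by simp at ha hb ⊢; omega) (by simp at ha hb ⊢; omega)
    simpa using this
  · rw [mem_vertsOf_fyEdges, flipY_add, flipY_flipY', flipY_lit]; simpa using h1
  · rw [mem_vertsOf_fyEdges, flipY_add, flipY_flipY', flipY_lit]; simpa using h2
  · rw [mem_vertsOf_fyEdges, flipY_add, flipY_flipY', flipY_lit]; simpa using h3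

/-- the hypotheses of type B for the reflected pair, from the mirrored hypotheses. [cite: MadrasSlade1993, §3.2 ("by symmetry")] -/
theorem typeB'_flip (htP : o + ![0, -1] ∈ vertsOf P) (hwQ : o + ![0, 1] ∈ vertsOf Q) (hFP : FactsB' o P)
    (hrowQ : ∀ v ∈ vertsOf Q, -3 ≤ v 1 - o 1 → v 1 - o 1 ≤ 1 → o 0 ≤ v 0)
    (hQ1 : o + ![0, -1] ∉ vertsOf Q) (hQ2 : o + ![1, 0] ∉ vertsOf Q) (hQ3 : o + ![1, -2] ∉ vertsOf Q)
    (hsep : ∀ a ∈ vertsOf P, ∀ b ∈ vertsOf Q, a 1 = b 1 → a 0 ≤ b 0) :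
    flipY o + ![0, 1] ∈ vertsOf (fyEdges P) ∧ flipY o + ![0, -1] ∈ vertsOf (fyEdges Q) ∧ FactsB (flipY o) (fyEdges P) ∧
      (∀ v ∈ vertsOf (fyEdges Q), -1 ≤ v 1 - flipY o 1 → v 1 - flipY o 1 ≤ 3 → flipY o 0 ≤ v 0) ∧
      flipY o + ![0, 1] ∉ vertsOf (fyEdges Q) ∧ flipY o + ![1, 0] ∉ vertsOf (fyEdges Q) ∧
      flipY o + ![1, 2] ∉ vertsOf (fyEdges Q) ∧
      (∀ a ∈ vertsOf (fyEdges P), ∀ b ∈ vertsOf (fyEdges Q), a 1 = b 1 → a 0 ≤ b 0) := by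
  have htP' : flipY o + ![0, 1] ∈ vertsOf (fyEdges P) := by
    rw [mem_vertsOf_fyEdges, flipY_add, flipY_flipY', flipY_lit]; exact htP
  have hwQ' : flipY o + ![0, -1] ∈ vertsOf (fyEdges Q) := by
    rw [mem_vertsOf_fyEdges, flipY_add, flipY_flipY', flipY_lit, neg_neg]; exact hwQ
  have hrowQ' : ∀ v ∈ vertsOf (fyEdges Q), -1 ≤ v 1 - flipY o 1 → v 1 - flipY o 1 ≤ 3 → flipY o 0 ≤ v 0 := by
    intro v hv ha hb
    have hv' := mem_vertsOf_fyEdges.1 hv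
    have := hrowQ _ hv' (by simp at ha hb ⊢; omega) (by simp at ha hb ⊢; omega)
    simpa using this
  have hQ1' : flipY o + ![0, 1] ∉ vertsOf (fyEdges Q) := by
    rw [mem_vertsOf_fyEdges, flipY_add, flipY_flipY', flipY_lit]; exact hQ1
  have hQ2' : flipY o + ![1, 0] ∉ vertsOf (fyEdges Q) := by
    rw [mem_vertsOf_fyEdges, flipY_add, flipY_flipY', flipY_lit]; simpa using hQ2
  have hQ3' : flipY o + ![1, 2] ∉ vertsOf (fyEdges Q) := by
    rw [mem_vertsOf_fyEdges, flipY_add, flipY_flipY', flipY_lit]; exact hQ3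
  have hsep' : ∀ a ∈ vertsOf (fyEdges P), ∀ b ∈ vertsOf (fyEdges Q), a 1 = b 1 → a 0 ≤ b 0 := by
    intro a ha b hb hrow
    have ha' := mem_vertsOf_fyEdges.1 ha
    have hb' := mem_vertsOf_fyEdges.1 hb
    have := hsep _ ha' _ hb' (by simp; exact hrow)
    simpa using this
  exact ⟨htP', hwQ', factsB_of_factsB' hFP, hrowQ', hQ1', hQ2', hQ3', hsep'⟩

/-- **The mirrored type B** (left polygon below the column contact): the join loop with junction rhombus
`{p, p+(1,−1), p+(3,−1), p+(2,0)}`, from `exists_joinLoop_typeB` for the reflected pair.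
[cite: Hammond2015SAPJoining, §4.1 pp. 17–20 (arXiv v5); Madras1995LatticeAnimalsExponent, §2] -/
theorem exists_joinLoop_typeB' {N : ℕ} (hP : IsPolygon brickGraph P) (hQ : IsPolygon brickGraph Q)
    (hPN : P.card = N) (hQN : Q.card = N) (htP : o + ![0, -1] ∈ vertsOf P) (hwQ : o + ![0, 1] ∈ vertsOf Q)
    (hFP : FactsB' o P)
    (hrowQ : ∀ v ∈ vertsOf Q, -3 ≤ v 1 - o 1 → v 1 - o 1 ≤ 1 → o 0 ≤ v 0)
    (hQ1 : o + ![0, -1] ∉ vertsOf Q) (hQ2 : o + ![1, 0] ∉ vertsOf Q) (hQ3 : o + ![1, -2] ∉ vertsOf Q)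
    (hsep : ∀ a ∈ vertsOf P, ∀ b ∈ vertsOf Q, a 1 = b 1 → a 0 ≤ b 0) :
    ∃ ρ, JoinLoop (N + 4) ![1, -1] ![3, -1] (flipY (flipY o + ![1, 0]))
      (fyEdges (capBt (flipY o) (fyEdges P))) (fyEdges (capBtQ (flipY o) (fyEdges Q))) ρ := by
  have hP' := isPolygon_fyEdges hP
  have hQ' := isPolygon_fyEdges hQ
  have hPN' : (fyEdges P).card = N := by rw [card_fyEdges, hPN]
  have hQN' : (fyEdges Q).card = N := by rw [card_fyEdges, hQN]
  obtain ⟨htP', hwQ', hF', hrowQ', hQ1', hQ2', hQ3', hsep'⟩ := typeB'_flip htP hwQ hFP hrowQ hQ1 hQ2 hQ3 hsep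
  obtain ⟨ρ, h⟩ := exists_joinLoop_typeB hP' hQ' hPN' hQN' htP' hwQ' hF' hrowQ' hQ1' hQ2' hQ3' hsep'
  refine ⟨flipW ρ, ?_⟩
  have h' := h.flip
  rw [flipY_lit, flipY_lit] at h'
  exact h'

end TriJoin

end Literature.Probability.RandomPlanarGeometry.SAW

/-!
# Madras' join on `𝕋`: the join witness of a first-contact pair (S4𝕋 (a), the glue)

Topic `Literature/Probability/RandomPlanarGeometry` (lane «pcv-sawmu», LINE «TRI-MADRAS»; continues
`SAWTriangularPolygonJoinMirror.lean` (`JoinLoop`, the five constructions `exists_joinLoop_typeA/B/C/B'/C'`) and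
`SAWTriangularPolygonJoinSlide.lean` (`IsCloseShift`, `IsFirstContact`, `le_of_isFirstContact`)).

Source.  A. Hammond, arXiv:1504.05286 [Hammond2015SAPJoining], §4.1 pp. 17–20 (arXiv v5): after sliding the right polygon to the
first contact, "there is at least one vertex `z` such that the set `{z − e₂, z, z + e₂}` contains a vertex of `τ` and a vertex of
`σ'`", and no vertex of `τ` lies in the right corridor, none of `σ'` in the left corridor; N. Madras, J. Stat. Phys. 78 (1995)
[Madras1995LatticeAnimalsExponent], §2.  On `𝕋` (brick frame) the contact pairs are `t − w ∈ {(0,0), (0,±2), (−1,±1)}`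
(`contact_type_of_isFirstContact`); this file turns the two corridor facts of a first contact into the hypotheses of one of the
five constructions, by the lane's selection rule in its final, simplest form: a SHARED site if there is one (type A), else a
DIAGONAL pair (type C or its mirror C'), else a COLUMN pair (type B or its mirror B') — no extremal choice is needed, because the
constructions' hypotheses only use the corridors and the absence of the earlier kinds (design note
`HOME/pub-sawmu-a-p4/g10/DESIGN-tri-cap.md` §1).

## Contents (namespace `Literature.Probability.RandomPlanarGeometry.SAW.TriJoin`)
* `JoinWitness N P Q ρ` — `ρ` is the join loop of one of the five constructions applied to `(P, Q)` with its hypotheses;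
* **`exists_joinWitness`** — two `N`-edge brick polygons in first-contact position (corridor fact + a close pair) have a join witness.
-/

open Finset SimpleGraph Literature.Probability.LatticeModels Literature.Probability.Percolation
open Literature.Barriers.CriticalPhenomena.SupercriticalSAW (shiftEdges mem_shiftEdges_iff card_shiftEdges)
open Literature.Probability.Percolation.SiteGadgetSystem (vertsOf mem_vertsOf)

namespace Literature.Probability.RandomPlanarGeometry.SAW

namespace TriJoin

open TriPolygon (flipY IsCloseShift)

variable {P Q : Finset (Sym2 (Site 2))} {N : ℕ}

/-- coordinates of a literal site. [folklore] -/
@[simp] private theorem vc0 (a b : ℤ) : (![a, b] : Site 2) 0 = a := rfl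
/-- coordinates of a literal site. [folklore] -/
@[simp] private theorem vc1 (a b : ℤ) : (![a, b] : Site 2) 1 = b := rfl
/-- two sites are equal iff their coordinates are. [folklore] -/
private theorem site_eq (x y : Site 2) : x = y ↔ x 0 = y 0 ∧ x 1 = y 1 :=
  ⟨fun h => by rw [h]; exact ⟨rfl, rfl⟩, fun h => by funext i; fin_cases i <;> simp [h.1, h.2]⟩

/-- **The join witness**: `ρ` is the join loop produced by one of the five constructions (A, B, C, mirrored B', mirrored C')
applied to the positioned pair `(P, Q)` under that construction's hypotheses.
[cite: Hammond2015SAPJoining, §4.1 pp. 17–20 (arXiv v5); Madras1995LatticeAnimalsExponent, §2] -/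
def JoinWitness (N : ℕ) (P Q : Finset (Sym2 (Site 2))) (ρ : ℕ → Site 2) : Prop :=
  (∃ t : Site 2, t ∈ vertsOf P ∧ t ∈ vertsOf Q ∧
      (∀ v ∈ vertsOf P, -2 ≤ v 1 - t 1 → v 1 - t 1 ≤ 2 → v 0 ≤ t 0) ∧
      (∀ v ∈ vertsOf Q, -2 ≤ v 1 - t 1 → v 1 - t 1 ≤ 2 → t 0 ≤ v 0) ∧
      (∀ a ∈ vertsOf P, ∀ b ∈ vertsOf Q, a 1 = b 1 → a 0 ≤ b 0) ∧
      JoinLoop (N + 4) ![1, 1] ![3, 1] (t + ![2, 0]) (capAt t P) (capAtQ t Q) ρ) ∨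
  (∃ o : Site 2, o + ![0, 1] ∈ vertsOf P ∧ o + ![0, -1] ∈ vertsOf Q ∧ FactsB o P ∧
      (∀ v ∈ vertsOf Q, -1 ≤ v 1 - o 1 → v 1 - o 1 ≤ 3 → o 0 ≤ v 0) ∧
      o + ![0, 1] ∉ vertsOf Q ∧ o + ![1, 0] ∉ vertsOf Q ∧ o + ![1, 2] ∉ vertsOf Q ∧
      (∀ a ∈ vertsOf P, ∀ b ∈ vertsOf Q, a 1 = b 1 → a 0 ≤ b 0) ∧
      JoinLoop (N + 4) ![1, 1] ![3, 1] (o + ![1, 0]) (capBt o P) (capBtQ o Q) ρ) ∨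
  (∃ t : Site 2, t ∈ vertsOf P ∧ t + ![1, -1] ∈ vertsOf Q ∧ FactsC t P ∧
      (∀ v ∈ vertsOf Q, -2 ≤ v 1 - t 1 → v 1 - t 1 ≤ 2 → t 0 ≤ v 0) ∧ t ∉ vertsOf Q ∧
      (∀ a ∈ vertsOf P, ∀ b ∈ vertsOf Q, a 1 = b 1 → a 0 < b 0) ∧
      JoinLoop (N + 4) ![1, 1] ![3, 1] (juncCt t P) (capCt t P) (capCtQ t P Q) ρ) ∨
  (∃ o : Site 2, o + ![0, -1] ∈ vertsOf P ∧ o + ![0, 1] ∈ vertsOf Q ∧ FactsB' o P ∧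
      (∀ v ∈ vertsOf Q, -3 ≤ v 1 - o 1 → v 1 - o 1 ≤ 1 → o 0 ≤ v 0) ∧
      o + ![0, -1] ∉ vertsOf Q ∧ o + ![1, 0] ∉ vertsOf Q ∧ o + ![1, -2] ∉ vertsOf Q ∧
      (∀ a ∈ vertsOf P, ∀ b ∈ vertsOf Q, a 1 = b 1 → a 0 ≤ b 0) ∧
      JoinLoop (N + 4) ![1, -1] ![3, -1] (flipY (flipY o + ![1, 0]))
        (fyEdges (capBt (flipY o) (fyEdges P))) (fyEdges (capBtQ (flipY o) (fyEdges Q))) ρ) ∨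
  (∃ t : Site 2, t ∈ vertsOf P ∧ t + ![1, 1] ∈ vertsOf Q ∧ FactsC' t P ∧
      (∀ v ∈ vertsOf Q, -2 ≤ v 1 - t 1 → v 1 - t 1 ≤ 2 → t 0 ≤ v 0) ∧ t ∉ vertsOf Q ∧
      (∀ a ∈ vertsOf P, ∀ b ∈ vertsOf Q, a 1 = b 1 → a 0 < b 0) ∧
      JoinLoop (N + 4) ![1, -1] ![3, -1] (flipY (juncCt (flipY t) (fyEdges P)))
        (fyEdges (capCt (flipY t) (fyEdges P))) (fyEdges (capCtQ (flipY t) (fyEdges P) (fyEdges Q))) ρ)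

/-- **The glue**: two `N`-edge brick polygons `P` (left) and `Q` (right) in FIRST-CONTACT position — every site of `P` within two
rows of a site of `Q` is weakly to its left, and some pair of sites is close (`IsCloseShift · · 0`) — admit a join witness.
[cite: Hammond2015SAPJoining, §4.1 pp. 17–20 (arXiv v5: the vertex `z`, the two corridors); Madras1995LatticeAnimalsExponent, §2] -/
theorem exists_joinWitness (hP : IsPolygon brickGraph P) (hQ : IsPolygon brickGraph Q)
    (hPN : P.card = N) (hQN : Q.card = N)
    (F1 : ∀ a ∈ vertsOf P, ∀ b ∈ vertsOf Q, b 1 ≤ a 1 + 2 → a 1 ≤ b 1 + 2 → a 0 ≤ b 0)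
    (F2 : ∃ a ∈ vertsOf P, ∃ b ∈ vertsOf Q, IsCloseShift a b 0) : ∃ ρ, JoinWitness N P Q ρ := by
  have hsepw : ∀ a ∈ vertsOf P, ∀ b ∈ vertsOf Q, a 1 = b 1 → a 0 ≤ b 0 :=
    fun a ha b hb h => F1 a ha b hb (by omega) (by omega)
  by_cases hA : ∃ t, t ∈ vertsOf P ∧ t ∈ vertsOf Q
  · -- type A: a shared site
    obtain ⟨t, htP, htQ⟩ := hA
    have hPA : ∀ v ∈ vertsOf P, -2 ≤ v 1 - t 1 → v 1 - t 1 ≤ 2 → v 0 ≤ t 0 :=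
      fun v hv h1 h2 => F1 v hv t htQ (by omega) (by omega)
    have hQA : ∀ v ∈ vertsOf Q, -2 ≤ v 1 - t 1 → v 1 - t 1 ≤ 2 → t 0 ≤ v 0 :=
      fun v hv h1 h2 => F1 t htP v hv (by omega) (by omega)
    obtain ⟨ρ, hρ⟩ := exists_joinLoop_typeA hP hQ hPN hQN htP htQ hPA hQA hsepw
    exact ⟨ρ, Or.inl ⟨t, htP, htQ, hPA, hQA, hsepw, hρ⟩⟩
  push Not at hA
  -- no shared site: the separation is strict
  have hseps : ∀ a ∈ vertsOf P, ∀ b ∈ vertsOf Q, a 1 = b 1 → a 0 < b 0 := by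
    intro a ha b hb hrow
    have hle := hsepw a ha b hb hrow
    rcases hle.lt_or_eq with h | h
    · exact h
    · exact absurd ((site_eq a b).2 ⟨h, hrow⟩ ▸ hb) (hA a ha)
  by_cases hC : ∃ t, t ∈ vertsOf P ∧ t + ![1, -1] ∈ vertsOf Q
  · -- type C: a diagonal pair, right polygon below-right
    obtain ⟨t, htP, hwQ⟩ := hC
    have hFP : FactsC t P := by
      refine ⟨fun v hv h1 h2 => ?_, fun h => hA _ h hwQ⟩
      have := F1 v hv _ hwQ (by (simp only [Pi.add_apply, vc1]; omega)) (by (simp only [Pi.add_apply, vc1]; omega))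
      (simp only [Pi.add_apply, vc0] at this ⊢; omega)
    have hrowQ : ∀ v ∈ vertsOf Q, -2 ≤ v 1 - t 1 → v 1 - t 1 ≤ 2 → t 0 ≤ v 0 :=
      fun v hv h1 h2 => F1 t htP v hv (by omega) (by omega)
    obtain ⟨ρ, hρ⟩ := exists_joinLoop_typeC hP hQ hPN hQN htP hwQ hFP hrowQ (hA t htP) hseps
    exact ⟨ρ, Or.inr (Or.inr (Or.inl ⟨t, htP, hwQ, hFP, hrowQ, hA t htP, hseps, hρ⟩))⟩
  push Not at hC
  by_cases hC' : ∃ t, t ∈ vertsOf P ∧ t + ![1, 1] ∈ vertsOf Q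
  · -- mirrored type C': a diagonal pair, right polygon above-right
    obtain ⟨t, htP, hwQ⟩ := hC'
    have hFP : FactsC' t P := by
      refine ⟨fun v hv h1 h2 => ?_, fun h => hA _ h hwQ⟩
      have := F1 v hv _ hwQ (by (simp only [Pi.add_apply, vc1]; omega)) (by (simp only [Pi.add_apply, vc1]; omega))
      (simp only [Pi.add_apply, vc0] at this ⊢; omega)
    have hrowQ : ∀ v ∈ vertsOf Q, -2 ≤ v 1 - t 1 → v 1 - t 1 ≤ 2 → t 0 ≤ v 0 :=
      fun v hv h1 h2 => F1 t htP v hv (by omega) (by omega)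
    obtain ⟨ρ, hρ⟩ := exists_joinLoop_typeC' hP hQ hPN hQN htP hwQ hFP hrowQ (hA t htP) hseps
    exact ⟨ρ, Or.inr (Or.inr (Or.inr (Or.inr ⟨t, htP, hwQ, hFP, hrowQ, hA t htP, hseps, hρ⟩)))⟩
  push Not at hC'
  -- only column pairs are left
  obtain ⟨a, ha, b, hb, hclose⟩ := F2
  have hle := F1 a ha b hb (by unfold TriPolygon.IsCloseShift at hclose; omega)
    (by unfold TriPolygon.IsCloseShift at hclose; omega)
  have hcol : a 0 = b 0 ∧ (a 1 = b 1 + 2 ∨ a 1 + 2 = b 1) := by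
    unfold TriPolygon.IsCloseShift at hclose
    rcases hclose with ⟨h0, h1 | h1 | h1⟩ | ⟨h0, h1⟩
    · exact absurd ((site_eq a b).2 ⟨by omega, h1⟩ ▸ hb) (hA a ha)
    · exact ⟨by omega, Or.inl h1⟩
    · exact ⟨by omega, Or.inr h1⟩
    · exfalso
      rcases h0 with h0 | h0
      · omega
      rcases h1 with h1 | h1
      · refine hC a ha ?_
        have e : a + ![1, -1] = b := (site_eq _ _).2 ⟨by (simp only [Pi.add_apply, vc0]; omega), by (simp only [Pi.add_apply, vc1]; omega)⟩
        rw [e]; exact hb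
      · refine hC' a ha ?_
        have e : a + ![1, 1] = b := (site_eq _ _).2 ⟨by (simp only [Pi.add_apply, vc0]; omega), by (simp only [Pi.add_apply, vc1]; omega)⟩
        rw [e]; exact hb
  obtain ⟨h0, h1 | h1⟩ := hcol
  · -- type B: the left polygon is above
    set o : Site 2 := a - ![0, 1] with ho
    have ea : o + ![0, 1] = a := by rw [ho, sub_add_cancel]
    have eb : o + ![0, -1] = b := (site_eq _ _).2 ⟨by rw [ho]; (simp only [Pi.add_apply, Pi.sub_apply, vc0]; omega), by rw [ho]; (simp only [Pi.add_apply, Pi.sub_apply, vc1]; omega)⟩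
    have htP : o + ![0, 1] ∈ vertsOf P := by rw [ea]; exact ha
    have hwQ : o + ![0, -1] ∈ vertsOf Q := by rw [eb]; exact hb
    have hFP : FactsB o P := by
      refine ⟨fun v hv hv1 hv2 => ?_, fun h => hA _ h hwQ, fun h => ?_, fun h => ?_⟩
      · have := F1 v hv _ hwQ (by (simp only [Pi.add_apply, vc1]; omega)) (by (simp only [Pi.add_apply, vc1]; omega))
        rw [ho] at this ⊢; (simp only [Pi.add_apply, Pi.sub_apply, vc0] at this ⊢; omega)
      · refine hC _ h ?_
        have e : o + ![-1, 0] + ![1, -1] = o + ![0, -1] := (site_eq _ _).2 ⟨by (simp only [Pi.add_apply, vc0]; omega), by (simp only [Pi.add_apply, vc1]; omega)⟩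
        rw [e]; exact hwQ
      · refine hC' _ h ?_
        have e : o + ![-1, -2] + ![1, 1] = o + ![0, -1] := (site_eq _ _).2 ⟨by (simp only [Pi.add_apply, vc0]; omega), by (simp only [Pi.add_apply, vc1]; omega)⟩
        rw [e]; exact hwQ
    have hrowQ : ∀ v ∈ vertsOf Q, -1 ≤ v 1 - o 1 → v 1 - o 1 ≤ 3 → o 0 ≤ v 0 := by
      intro v hv hv1 hv2
      have := F1 _ htP v hv (by (simp only [Pi.add_apply, vc1]; omega)) (by (simp only [Pi.add_apply, vc1]; omega))
      (simp only [Pi.add_apply, vc0] at this ⊢; omega)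
    have hQ1 : o + ![0, 1] ∉ vertsOf Q := hA _ htP
    have hQ2 : o + ![1, 0] ∉ vertsOf Q := by
      intro h
      refine hC _ htP ?_
      have e : o + ![0, 1] + ![1, -1] = o + ![1, 0] := (site_eq _ _).2 ⟨by (simp only [Pi.add_apply, vc0]; omega), by (simp only [Pi.add_apply, vc1]; omega)⟩
      rw [e]; exact h
    have hQ3 : o + ![1, 2] ∉ vertsOf Q := by
      intro h
      refine hC' _ htP ?_
      have e : o + ![0, 1] + ![1, 1] = o + ![1, 2] := (site_eq _ _).2 ⟨by (simp only [Pi.add_apply, vc0]; omega), by (simp only [Pi.add_apply, vc1]; omega)⟩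
      rw [e]; exact h
    obtain ⟨ρ, hρ⟩ := exists_joinLoop_typeB hP hQ hPN hQN htP hwQ hFP hrowQ hQ1 hQ2 hQ3 hsepw
    exact ⟨ρ, Or.inr (Or.inl ⟨o, htP, hwQ, hFP, hrowQ, hQ1, hQ2, hQ3, hsepw, hρ⟩)⟩
  · -- mirrored type B': the left polygon is below
    set o : Site 2 := a + ![0, 1] with ho
    have ea : o + ![0, -1] = a := (site_eq _ _).2 ⟨by rw [ho]; (simp only [Pi.add_apply, vc0]; omega), by rw [ho]; (simp only [Pi.add_apply, vc1]; omega)⟩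
    have eb : o + ![0, 1] = b := (site_eq _ _).2 ⟨by rw [ho]; (simp only [Pi.add_apply, vc0]; omega), by rw [ho]; (simp only [Pi.add_apply, vc1]; omega)⟩
    have htP : o + ![0, -1] ∈ vertsOf P := by rw [ea]; exact ha
    have hwQ : o + ![0, 1] ∈ vertsOf Q := by rw [eb]; exact hb
    have hFP : FactsB' o P := by
      refine ⟨fun v hv hv1 hv2 => ?_, fun h => hA _ h hwQ, fun h => ?_, fun h => ?_⟩
      · have := F1 v hv _ hwQ (by (simp only [Pi.add_apply, vc1]; omega)) (by (simp only [Pi.add_apply, vc1]; omega))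
        rw [ho] at this ⊢; (simp only [Pi.add_apply, vc0] at this ⊢; omega)
      · refine hC' _ h ?_
        have e : o + ![-1, 0] + ![1, 1] = o + ![0, 1] := (site_eq _ _).2 ⟨by (simp only [Pi.add_apply, vc0]; omega), by (simp only [Pi.add_apply, vc1]; omega)⟩
        rw [e]; exact hwQ
      · refine hC _ h ?_
        have e : o + ![-1, 2] + ![1, -1] = o + ![0, 1] := (site_eq _ _).2 ⟨by (simp only [Pi.add_apply, vc0]; omega), by (simp only [Pi.add_apply, vc1]; omega)⟩
        rw [e]; exact hwQ
    have hrowQ : ∀ v ∈ vertsOf Q, -3 ≤ v 1 - o 1 → v 1 - o 1 ≤ 1 → o 0 ≤ v 0 := by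
      intro v hv hv1 hv2
      have := F1 _ htP v hv (by (simp only [Pi.add_apply, vc1]; omega)) (by (simp only [Pi.add_apply, vc1]; omega))
      (simp only [Pi.add_apply, vc0] at this ⊢; omega)
    have hQ1 : o + ![0, -1] ∉ vertsOf Q := hA _ htP
    have hQ2 : o + ![1, 0] ∉ vertsOf Q := by
      intro h
      refine hC' _ htP ?_
      have e : o + ![0, -1] + ![1, 1] = o + ![1, 0] := (site_eq _ _).2 ⟨by (simp only [Pi.add_apply, vc0]; omega), by (simp only [Pi.add_apply, vc1]; omega)⟩
      rw [e]; exact h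
    have hQ3 : o + ![1, -2] ∉ vertsOf Q := by
      intro h
      refine hC _ htP ?_
      have e : o + ![0, -1] + ![1, -1] = o + ![1, -2] := (site_eq _ _).2 ⟨by (simp only [Pi.add_apply, vc0]; omega), by (simp only [Pi.add_apply, vc1]; omega)⟩
      rw [e]; exact h
    obtain ⟨ρ, hρ⟩ := exists_joinLoop_typeB' hP hQ hPN hQN htP hwQ hFP hrowQ hQ1 hQ2 hQ3 hsepw
    exact ⟨ρ, Or.inr (Or.inr (Or.inr (Or.inl ⟨o, htP, hwQ, hFP, hrowQ, hQ1, hQ2, hQ3, hsepw, hρ⟩)))⟩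

end TriJoin

end Literature.Probability.RandomPlanarGeometry.SAW

/-!
# Madras' join on `𝕋`: decoding a join witness (S4𝕋 (b), injectivity up to the canonical traversal)

Topic `Literature/Probability/RandomPlanarGeometry` (lane «pcv-sawmu», LINE «TRI-MADRAS»; continues `SAWTriangularPolygonJoinMap.lean`
(`JoinWitness`), `SAWTriangularPolygonJoinMerge.lean` (`arcEdges`, `eq_arcEdges`) and the junction-frame decoder of
`SAWTriangularPolygonJoinCap.lean` §(7) (`capA_ne_capB`, …, `eq_of_pictureC_eq`)).

Source.  N. Madras, J. Stat. Phys. 78 (1995) [Madras1995LatticeAnimalsExponent], §2: the join is injective — the joined polygon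
determines the two polygons and their relative position; A. Hammond, arXiv:1504.05286 [Hammond2015SAPJoining], §3.2 p. 10 («the
application (φ, φ′) → χ is injective, because from χ we can detect the location of the plaquette») and §4.4 p. 27, (4.9) (arXiv v5;
§4.2 there is «Global join plaquettes are few», not used here).  Here: if the SAME closing walk `ρ` is a join witness for two positioned pairs `(P₁, Q₁)` and `(P₂, Q₂)`, then the pairs
are translates of each other by one common vector.  The proof reads the two halves of `ρ` as edge sets (`arcEdges`), brings every
contact type to a normal form (`formP`, `formQ` of the contact-frame polygon), separates the types by the junction signatures, and
inverts the cap rules.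

## Contents (namespace `Literature.Probability.RandomPlanarGeometry.SAW.TriJoin`)
* `Kind`, `formP`, `formQ`, `Good` — normal forms of the five contact types; `formP_inj`, `formQ_inj` (decoding of normal forms);
* `JoinLoop.relP_eq`, `JoinLoop.relQ_eq` — the capped polygons, translated by `−j`, are the arc edge sets of `ρ`;
* `JoinWitness.normalForm` — every witness in normal form;
* **`JoinWitness.translate`** — two pairs with a common join loop are common translates.
-/

open Finset SimpleGraph Literature.Probability.LatticeModels Literature.Probability.Percolation
open Literature.Barriers.CriticalPhenomena.SupercriticalSAW (shiftEdges mem_shiftEdges_iff card_shiftEdges shiftEdges_injective)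
open Literature.Probability.Percolation.SiteGadgetSystem (vertsOf mem_vertsOf)

namespace Literature.Probability.RandomPlanarGeometry.SAW

namespace TriJoin

open TriPolygon (flipY flipW loops mem_loops arcEdges eq_arcEdges inj_of_mem_loops)
open TriCap (capA capB capC juncC CorrA CorrB CorrC)

variable {P Q E F : Finset (Sym2 (Site 2))} {t o c j u w a b : Site 2} {M N : ℕ} {ρ : ℕ → Site 2}

/-- coordinates of a literal site. [folklore] -/
@[simp] private theorem wc0 (a b : ℤ) : (![a, b] : Site 2) 0 = a := rfl
/-- coordinates of a literal site. [folklore] -/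
@[simp] private theorem wc1 (a b : ℤ) : (![a, b] : Site 2) 1 = b := rfl
/-- two sites are equal iff their coordinates are. [folklore] -/
private theorem site_eq₂ (x y : Site 2) : x = y ↔ x 0 = y 0 ∧ x 1 = y 1 :=
  ⟨fun h => by rw [h]; exact ⟨rfl, rfl⟩, fun h => by funext i; fin_cases i <;> simp [h.1, h.2]⟩
/-- `flipY`, coordinates. [folklore] -/
@[simp] private theorem flipY_c0 (z : Site 2) : flipY z 0 = z 0 := rfl
/-- `flipY`, coordinates. [folklore] -/
@[simp] private theorem flipY_c1 (z : Site 2) : flipY z 1 = -z 1 := rfl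

/-! ### Edge-set algebra: membership of a concrete edge in the transformed sets -/

/-- a concrete edge in `fyEdges` (restated with `flipY` moved to the other side). [folklore] -/
private theorem mem_fy {a b : Site 2} : s(a, b) ∈ fyEdges E ↔ s(flipY a, flipY b) ∈ E := mk_mem_fyEdges_iff

/-- Two edge sets are equal as soon as they contain the same concrete edges. [folklore] -/
private theorem ext_mk {X Y : Finset (Sym2 (Site 2))} (h : ∀ a b : Site 2, s(a, b) ∈ X ↔ s(a, b) ∈ Y) : X = Y := by
  ext e; induction e using Sym2.ind with
  | _ a b => exact h a b

/-! ### Normal forms of the contact types -/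

/-- the three cap rules. [cite: Hammond2015SAPJoining, §4.1 p. 18 (arXiv v5)] -/
inductive Kind | A | B | C
  deriving DecidableEq

/-- the LEFT capped polygon in the junction frame (`capX E − j`). [cite: Hammond2015SAPJoining, §4.1 p. 18 (arXiv v5)] -/
def formP : Kind → Finset (Sym2 (Site 2)) → Finset (Sym2 (Site 2))
  | .A, E => shiftEdges (-![2, 0]) (capA E)
  | .B, E => shiftEdges (-![1, 0]) (capB E)
  | .C, E => shiftEdges (-juncC E) (capC E)

/-- the RIGHT capped polygon in the junction frame (rotated: `(3,1) − (capX E − j_Q)`). [cite: Hammond2015SAPJoining, §4.1 p. 18 (arXiv v5)] -/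
def formQ : Kind → Finset (Sym2 (Site 2)) → Finset (Sym2 (Site 2))
  | .A, E => ptEdges ![4, 0] (capA E)
  | .B, E => ptEdges ![3, 0] (capB E)
  | .C, E => ptEdges ![3, 1] (shiftEdges (-juncC E) (capC E))

/-- the hypotheses of the cap rule in the contact frame. [cite: Hammond2015SAPJoining, §4.1 p. 18 (arXiv v5)] -/
def Good : Kind → Finset (Sym2 (Site 2)) → Prop
  | .A, E => CorrA E ∧ (![0, 0] : Site 2) ∈ vertsOf E ∧ IsPolygon brickGraph E
  | .B, E => CorrB E ∧ (![0, 1] : Site 2) ∈ vertsOf E ∧ IsPolygon brickGraph E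
  | .C, E => CorrC E ∧ (![0, 0] : Site 2) ∈ vertsOf E ∧ IsPolygon brickGraph E

/-- the offset of the right polygon's rotation centre from the left base point. [cite: Hammond2015SAPJoining, §4.1 p. 18 (arXiv v5)] -/
def offQ : Kind → Site 2
  | .A => 0
  | .B => 0
  | .C => ![1, -1]

/-- **Decoding the left normal form**: equal junction-frame pictures have the same kind and the same contact-frame polygon.
[cite: Madras1995LatticeAnimalsExponent, §2 (the join is injective)] -/
theorem formP_inj {k₁ k₂ : Kind} {E₁ E₂ : Finset (Sym2 (Site 2))} (g₁ : Good k₁ E₁) (g₂ : Good k₂ E₂)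
    (h : formP k₁ E₁ = formP k₂ E₂) : k₁ = k₂ ∧ E₁ = E₂ := by
  cases k₁ <;> cases k₂ <;> simp only [formP, Good] at h g₁ g₂
  · exact ⟨rfl, TriCap.eq_of_pictureA_eq g₁.1 g₂.1 g₁.2.1 g₂.2.1 g₁.2.2 g₂.2.2 h⟩
  · exact absurd h (TriCap.capA_ne_capB g₁.1 g₂.1)
  · exact absurd h (TriCap.capA_ne_capC g₁.1 g₂.1)
  · exact absurd h.symm (TriCap.capA_ne_capB g₂.1 g₁.1)
  · exact ⟨rfl, TriCap.eq_of_pictureB_eq g₁.1 g₂.1 g₁.2.1 g₂.2.1 g₁.2.2 g₂.2.2 h⟩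
  · exact absurd h (TriCap.capB_ne_capC g₁.1 g₂.1)
  · exact absurd h.symm (TriCap.capA_ne_capC g₂.1 g₁.1)
  · exact absurd h.symm (TriCap.capB_ne_capC g₂.1 g₁.1)
  · exact ⟨rfl, TriCap.eq_of_pictureC_eq g₁.1 g₂.1 g₁.2.1 g₂.2.1 g₁.2.2 g₂.2.2 h⟩

/-- `ptEdges c` is injective. [folklore] -/
private theorem ptEdges_injective (c : Site 2) {X Y : Finset (Sym2 (Site 2))} (h : ptEdges c X = ptEdges c Y) : X = Y := by
  rw [← ptEdges_ptEdges c X, h, ptEdges_ptEdges]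

/-- **Decoding the right normal form** (same kind). [cite: Madras1995LatticeAnimalsExponent, §2 (the join is injective)] -/
theorem formQ_inj {k : Kind} {E₁ E₂ : Finset (Sym2 (Site 2))} (g₁ : Good k E₁) (g₂ : Good k E₂)
    (h : formQ k E₁ = formQ k E₂) : E₁ = E₂ := by
  cases k <;> simp only [formQ, Good] at h g₁ g₂
  · exact TriCap.capA_injective g₁.1 g₂.1 g₁.2.1 g₂.2.1 g₁.2.2 g₂.2.2 (ptEdges_injective _ h)
  · exact TriCap.capB_injective g₁.1 g₂.1 g₁.2.1 g₂.2.1 g₁.2.2 g₂.2.2 (ptEdges_injective _ h)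
  · exact TriCap.eq_of_pictureC_eq g₁.1 g₂.1 g₁.2.1 g₂.2.1 g₁.2.2 g₂.2.2 (ptEdges_injective _ h)

/-! ### The two halves of the join loop as edge sets -/

/-- translating `arcEdges`. [folklore] -/
private theorem arcEdges_shift (ρ : ℕ → Site 2) (p : Site 2) (M : ℕ) :
    arcEdges ρ p M = shiftEdges p (arcEdges ρ 0 M) := by
  simp only [arcEdges, shiftEdges, Finset.image_insert, Finset.image_image, Function.comp_def, Sym2.map_mk,
    add_zero]

/-- undoing a translation. [folklore] -/
private theorem shiftEdges_neg_shiftEdges (p : Site 2) (X : Finset (Sym2 (Site 2))) :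
    shiftEdges (-p) (shiftEdges p X) = X := by
  rw [shiftEdges_shiftEdges, add_neg_cancel, shiftEdges_zero]

/-- **The left capped polygon, translated by `−j`, is the left arc edge set of the join loop.**
[cite: Hammond2015SAPJoining, §3.2 p. 10 and §4.4 p. 27, (4.9) (arXiv v5: the join polygon and its junction plaquette determine the two halves)] -/
theorem JoinLoop.relP_eq {FP FQ : Finset (Sym2 (Site 2))} (h3 : 3 ≤ M) (h : JoinLoop M u w j FP FQ ρ) :
    shiftEdges (-j) FP = arcEdges ρ 0 M := by
  obtain ⟨⟨cP, -, jP, -⟩, hl, h0, hu, -, -, -, -, -, -, eP, -, -⟩ := h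
  have hinj : ∀ i k, i < M → k < M → ρ i = ρ k → i = k :=
    fun i k hi hk hik => inj_of_mem_loops hl (by omega) (by omega) hik
  have hclose : s(ρ (M - 1) + j, ρ 0 + j) ∈ FP := by
    rw [hu, h0, zero_add, add_comm, Sym2.eq_swap]; exact jP
  rw [eq_arcEdges h3 cP hinj eP hclose, arcEdges_shift, shiftEdges_neg_shiftEdges]

/-- **The right capped polygon, translated by `−j`, is the right arc edge set of the join loop.**
[cite: Hammond2015SAPJoining, §3.2 p. 10 and §4.4 p. 27, (4.9) (arXiv v5: the join polygon and its junction plaquette determine the two halves)] -/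
theorem JoinLoop.relQ_eq {FP FQ : Finset (Sym2 (Site 2))} (h3 : 3 ≤ M) (h : JoinLoop M u w j FP FQ ρ) :
    shiftEdges (-j) FQ = arcEdges (fun i => ρ (i + M)) 0 M := by
  obtain ⟨⟨-, cQ, -, jQ⟩, hl, -, -, hw, hq, -, -, -, -, -, eQ, -⟩ := h
  have hinj : ∀ i k, i < M → k < M → ρ (i + M) = ρ (k + M) → i = k :=
    fun i k hi hk hik => by have := inj_of_mem_loops hl (by omega) (by omega) hik; omega
  have hedges : ∀ i, i + 1 < M → s(ρ (i + M) + j, ρ (i + 1 + M) + j) ∈ FQ := by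
    intro i hi
    have := eQ (i + M) (by omega) (by omega)
    rwa [show i + M + 1 = i + 1 + M by omega] at this
  have hclose : s(ρ (M - 1 + M) + j, ρ (0 + M) + j) ∈ FQ := by
    rw [show M - 1 + M = 2 * M - 1 by omega, Nat.zero_add, hq, hw, add_comm (![2, 0] : Site 2), add_comm w]; exact jQ
  rw [eq_arcEdges (ρ := fun i => ρ (i + M)) h3 cQ hinj hedges hclose, arcEdges_shift, shiftEdges_neg_shiftEdges]

/-! ### Every contact type in normal form -/

/-- `shiftEdges (−t) (ptEdges (t + t + d) Q) = ptEdges (t + d) Q`. [folklore] -/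
private theorem shift_pt (t d : Site 2) (Q : Finset (Sym2 (Site 2))) :
    shiftEdges (-t) (ptEdges (t + t + d) Q) = ptEdges (t + d) Q := by
  apply ext_mk; intro a b
  rw [mk_mem_shiftEdges_iff, mk_mem_ptEdges_iff, mk_mem_ptEdges_iff]
  have e1 : t + t + d - (a - -t) = t + d - a := by abel
  have e2 : t + t + d - (b - -t) = t + d - b := by abel
  rw [e1, e2]

/-- translation past the reflection. [folklore] -/
private theorem shiftEdges_fyEdges (p : Site 2) (X : Finset (Sym2 (Site 2))) :
    shiftEdges p (fyEdges X) = fyEdges (shiftEdges (flipY p) X) := by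
  apply ext_mk; intro a b
  rw [mk_mem_shiftEdges_iff, mem_fy, mem_fy, mk_mem_shiftEdges_iff]
  have e : ∀ z : Site 2, flipY (z - p) = flipY z - flipY p := fun z => by (refine (site_eq₂ _ _).2 ⟨?_, ?_⟩ <;> simp only [Pi.sub_apply, flipY_c0, flipY_c1]; omega)
  rw [e, e]

/-- `flipY` is an involution. [folklore] -/
private theorem flipY_inv (z : Site 2) : flipY (flipY z) = z := by (refine (site_eq₂ _ _).2 ⟨?_, ?_⟩ <;> simp only [flipY_c0, flipY_c1]; omega)
/-- `flipY` is additive. [folklore] -/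
private theorem flipY_add' (a b : Site 2) : flipY (a + b) = flipY a + flipY b := by (refine (site_eq₂ _ _).2 ⟨?_, ?_⟩ <;> simp only [Pi.add_apply, flipY_c0, flipY_c1]; omega)
/-- `flipY` of a negation. [folklore] -/
private theorem flipY_neg' (a : Site 2) : flipY (-a) = -flipY a := by (refine (site_eq₂ _ _).2 ⟨?_, ?_⟩ <;> simp only [Pi.neg_apply, flipY_c0, flipY_c1])

/-- **Normal form, type A.** [cite: Hammond2015SAPJoining, §4.1 p. 18 (arXiv v5)] -/
theorem normalA (t : Site 2) (P Q : Finset (Sym2 (Site 2))) :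
    shiftEdges (-(t + ![2, 0])) (capAt t P) = formP .A (shiftEdges (-t) P) ∧
    shiftEdges (-(t + ![2, 0])) (capAtQ t Q) = formQ .A (shiftEdges (-t) (ptEdges (t + t) Q)) := by
  constructor
  · rw [formP, capAt, shiftEdges_shiftEdges]; congr 1; abel
  · apply ext_mk; intro a b
    simp only [formQ, capAtQ, capAt, mk_mem_shiftEdges_iff, mk_mem_ptEdges_iff]
    have e : ∀ z : Site 2, t + t - (z - -(t + ![2, 0]) - ![6, 0]) - t = ![4, 0] - z := fun z => by (refine (site_eq₂ _ _).2 ⟨?_, ?_⟩ <;> simp only [Pi.add_apply, Pi.sub_apply, Pi.neg_apply, wc0, wc1] <;> omega)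
    rw [e, e]

/-- **Normal form, type B.** [cite: Hammond2015SAPJoining, §4.1 p. 18 (arXiv v5)] -/
theorem normalB (o : Site 2) (P Q : Finset (Sym2 (Site 2))) :
    shiftEdges (-(o + ![1, 0])) (capBt o P) = formP .B (shiftEdges (-o) P) ∧
    shiftEdges (-(o + ![1, 0])) (capBtQ o Q) = formQ .B (shiftEdges (-o) (ptEdges (o + o) Q)) := by
  constructor
  · rw [formP, capBt, shiftEdges_shiftEdges]; congr 1; abel
  · apply ext_mk; intro a b
    simp only [formQ, capBtQ, capBt, mk_mem_shiftEdges_iff, mk_mem_ptEdges_iff]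
    have e : ∀ z : Site 2, o + o - (z - -(o + ![1, 0]) - ![4, 0]) - o = ![3, 0] - z := fun z => by (refine (site_eq₂ _ _).2 ⟨?_, ?_⟩ <;> simp only [Pi.add_apply, Pi.sub_apply, Pi.neg_apply, wc0, wc1] <;> omega)
    rw [e, e]

/-- components of `juncC`. [cite: Hammond2015SAPJoining, §4.1 p. 18 (arXiv v5)] -/
private theorem juncC_coords (E : Finset (Sym2 (Site 2))) : (juncC E 0 = 1 ∨ juncC E 0 = 3) ∧ juncC E 1 = -1 := by
  rcases TriCap.juncC_cases' E with h | h <;> rw [h] <;> simp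

/-- **Normal form, type C.** [cite: Hammond2015SAPJoining, §4.1 p. 18 (arXiv v5)] -/
theorem normalC (t : Site 2) (P Q : Finset (Sym2 (Site 2))) :
    shiftEdges (-juncCt t P) (capCt t P) = formP .C (shiftEdges (-t) P) ∧
    shiftEdges (-juncCt t P) (capCtQ t P Q) = formQ .C (shiftEdges (-t) (ptEdges (t + t + ![1, -1]) Q)) := by
  constructor
  · rw [formP, capCt, juncCt, shiftEdges_shiftEdges]; congr 1; abel
  · apply ext_mk; intro a b
    obtain ⟨-, hP1⟩ := juncC_coords (shiftEdges (-t) P)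
    obtain ⟨-, hQ1⟩ := juncC_coords (shiftEdges (-t) (ptEdges (t + t + ![1, -1]) Q))
    set EQ := shiftEdges (-t) (ptEdges (t + t + ![1, -1]) Q)
    set jP := juncC (shiftEdges (-t) P)
    set jQ := juncC EQ
    have hT : shiftC t P Q = jP 0 + jQ 0 + 2 := rfl
    simp only [formQ, capCtQ, capCt, juncCt, hT, mk_mem_shiftEdges_iff, mk_mem_ptEdges_iff]
    have e : ∀ z : Site 2, t + t + ![1, -1] - (z - -(t + jP) - ![jP 0 + jQ 0 + 2, 0]) - t = ![3, 1] - z - -jQ := by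
      intro z
      refine (site_eq₂ _ _).2 ⟨?_, ?_⟩ <;>
        simp only [Pi.add_apply, Pi.sub_apply, Pi.neg_apply, wc0, wc1] <;> omega
    rw [e, e]

/-- **Normal form, mirrored type B'.** [cite: Hammond2015SAPJoining, §4.1 p. 18 (arXiv v5); MadrasSlade1993, §3.2 ("by symmetry")] -/
theorem normalB' (o : Site 2) (P Q : Finset (Sym2 (Site 2))) :
    shiftEdges (-flipY (flipY o + ![1, 0])) (fyEdges (capBt (flipY o) (fyEdges P))) =
      fyEdges (formP .B (shiftEdges (-flipY o) (fyEdges P))) ∧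
    shiftEdges (-flipY (flipY o + ![1, 0])) (fyEdges (capBtQ (flipY o) (fyEdges Q))) =
      fyEdges (formQ .B (shiftEdges (-flipY o) (ptEdges (flipY o + flipY o) (fyEdges Q)))) := by
  obtain ⟨h1, h2⟩ := normalB (flipY o) (fyEdges P) (fyEdges Q)
  have hf : flipY (-flipY (flipY o + ![1, 0])) = -(flipY o + ![1, 0]) := by rw [flipY_neg', flipY_inv]
  constructor
  · rw [shiftEdges_fyEdges, hf, h1]
  · rw [shiftEdges_fyEdges, hf, h2]

/-- **Normal form, mirrored type C'.** [cite: Hammond2015SAPJoining, §4.1 p. 18 (arXiv v5); MadrasSlade1993, §3.2 ("by symmetry")] -/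
theorem normalC' (t : Site 2) (P Q : Finset (Sym2 (Site 2))) :
    shiftEdges (-flipY (juncCt (flipY t) (fyEdges P))) (fyEdges (capCt (flipY t) (fyEdges P))) =
      fyEdges (formP .C (shiftEdges (-flipY t) (fyEdges P))) ∧
    shiftEdges (-flipY (juncCt (flipY t) (fyEdges P))) (fyEdges (capCtQ (flipY t) (fyEdges P) (fyEdges Q))) =
      fyEdges (formQ .C (shiftEdges (-flipY t) (ptEdges (flipY t + flipY t + ![1, -1]) (fyEdges Q)))) := by
  obtain ⟨h1, h2⟩ := normalC (flipY t) (fyEdges P) (fyEdges Q)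
  have hf : flipY (-flipY (juncCt (flipY t) (fyEdges P))) = -juncCt (flipY t) (fyEdges P) := by
    rw [flipY_neg', flipY_inv]
  constructor
  · rw [shiftEdges_fyEdges, hf, h1]
  · rw [shiftEdges_fyEdges, hf, h2]

/-! ### Normal form of a witness, and the translation theorem -/

/-- apply the reflection or not. [cite: MadrasSlade1993, §3.2 ("by symmetry")] -/
def mir : Bool → Finset (Sym2 (Site 2)) → Finset (Sym2 (Site 2))
  | true, X => fyEdges X
  | false, X => X

/-- `mir m` is injective. [folklore] -/
private theorem mir_inj {m : Bool} {X Y : Finset (Sym2 (Site 2))} (h : mir m X = mir m Y) : X = Y := by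
  cases m
  · exact h
  · simp only [mir] at h
    rw [← fyEdges_fyEdges X, h, fyEdges_fyEdges]

/-- the junction orientation: `(1,1)` for the standard rhombus, `(1,−1)` for the mirrored one. [cite: Hammond2015SAPJoining, Definition 4.3 (arXiv v5 p. 20)] -/
def uOf : Bool → Site 2
  | true => ![1, -1]
  | false => ![1, 1]

/-- `uOf` is injective. [folklore] -/
private theorem uOf_inj {m₁ m₂ : Bool} (h : uOf m₁ = uOf m₂) : m₁ = m₂ := by
  cases m₁ <;> cases m₂ <;> simp only [uOf] at h ⊢
  · exact absurd (congrFun h 1) (by decide)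
  · exact absurd (congrFun h 1) (by decide)

/-- `ptEdges c (shiftEdges (−t) (ptEdges (t + t + d) Q)) = Q` for `c = t + d`. [folklore] -/
private theorem pt_shift_pt (t d : Site 2) (Q : Finset (Sym2 (Site 2))) :
    ptEdges (t + d) (shiftEdges (-t) (ptEdges (t + t + d) Q)) = Q := by
  rw [shift_pt, ptEdges_ptEdges]

/-- `ptEdges t (shiftEdges (−t) (ptEdges (t + t) Q)) = Q`. [folklore] -/
private theorem pt_shift_pt₀ (t : Site 2) (Q : Finset (Sym2 (Site 2))) :
    ptEdges t (shiftEdges (-t) (ptEdges (t + t) Q)) = Q := by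
  have h := pt_shift_pt t 0 Q
  rwa [add_zero, add_zero] at h

/-- two point reflections compose to a translation. [folklore] -/
private theorem ptEdges_ptEdges' (a b : Site 2) (X : Finset (Sym2 (Site 2))) :
    ptEdges a (ptEdges b X) = shiftEdges (a - b) X := by
  apply ext_mk; intro x y
  rw [mk_mem_ptEdges_iff, mk_mem_ptEdges_iff, mk_mem_shiftEdges_iff]
  have e : ∀ z : Site 2, b - (a - z) = z - (a - b) := fun z => by abel
  rw [e, e]

/-- the reflection past a translation, the other way round. [folklore] -/
private theorem fyEdges_shiftEdges (q : Site 2) (Y : Finset (Sym2 (Site 2))) :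
    fyEdges (shiftEdges q Y) = shiftEdges (flipY q) (fyEdges Y) := by
  rw [shiftEdges_fyEdges, flipY_inv]

/-- a vertex of the polygon moved to the origin frame. [folklore] -/
private theorem mem_vertsOf_shift_neg₂ {v t : Site 2} {E : Finset (Sym2 (Site 2))} :
    v ∈ vertsOf (shiftEdges (-t) E) ↔ v + t ∈ vertsOf E := by
  rw [mem_vertsOf_shiftEdges, sub_neg_eq_add]

/-- **Normal form of a join witness.**  For a witness `ρ` of `(P, Q)` there are: an orientation bit `m`, a kind `k`, base points
`bP`, `bQ = bP + offQ k`, and contact-frame polygons `EP`, `EQ` satisfying the cap hypotheses, such that `ρ (M−1) = uOf m`, the two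
arc edge sets of `ρ` are `mir m (formP k EP)` and `mir m (formQ k EQ)`, and `P = mir m (EP + bP)`, `Q = mir m (ptEdges bQ EQ)`.
[cite: Hammond2015SAPJoining, §4.1 (arXiv v5 pp. 17–20: the construction); §3.2 p. 10 and §4.4 p. 27, (4.9) (injectivity); Madras1995LatticeAnimalsExponent, §2] -/
theorem JoinWitness.normalForm (hP : IsPolygon brickGraph P) (hQ : IsPolygon brickGraph Q) (h : JoinWitness N P Q ρ) :
    ∃ (m : Bool) (k : Kind) (bP bQ : Site 2) (EP EQ : Finset (Sym2 (Site 2))),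
      Good k EP ∧ Good k EQ ∧ bQ = bP + offQ k ∧ ρ (N + 4 - 1) = uOf m ∧
      arcEdges ρ 0 (N + 4) = mir m (formP k EP) ∧
      arcEdges (fun i => ρ (i + (N + 4))) 0 (N + 4) = mir m (formQ k EQ) ∧
      P = mir m (shiftEdges bP EP) ∧ Q = mir m (ptEdges bQ EQ) := by
  have h3 : 3 ≤ N + 4 := by omega
  rcases h with ⟨t, htP, htQ, hPA, hQA, -, hJ⟩ | ⟨o, htP, hwQ, hFB, hrowQ, hQ1, hQ2, hQ3, -, hJ⟩ |
      ⟨t, htP, hwQ, hFC, hrowQ, htQ, -, hJ⟩ | ⟨o, htP, hwQ, hFB, hrowQ, hQ1, hQ2, hQ3, hsep, hJ⟩ |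
      ⟨t, htP, hwQ, hFC, hrowQ, htQ, hsep, hJ⟩
  · -- type A
    obtain ⟨n1, n2⟩ := normalA t P Q
    refine ⟨false, .A, t, t, shiftEdges (-t) P, shiftEdges (-t) (ptEdges (t + t) Q),
      ⟨corrA_left hPA, zero_mem_left htP, isPolygon_shiftEdges_brick hP _⟩,
      ⟨corrA_right hQA, zero_mem_right htQ, isPolygon_shiftEdges_brick (isPolygon_ptEdges hQ _) _⟩,
      by simp [offQ], hJ.2.2.2.1, ?_, ?_, ?_, ?_⟩
    · rw [mir, ← n1, hJ.relP_eq h3]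
    · rw [mir, ← n2, hJ.relQ_eq h3]
    · rw [mir, shiftEdges_shiftEdges, neg_add_cancel, shiftEdges_zero]
    · rw [mir, pt_shift_pt₀]
  · -- type B
    obtain ⟨n1, n2⟩ := normalB o P Q
    have hv : (![0, 1] : Site 2) ∈ vertsOf (shiftEdges (-o) P) := by
      rw [mem_vertsOf_shift_neg₂, add_comm]; exact htP
    have hvQ : (![0, 1] : Site 2) ∈ vertsOf (shiftEdges (-o) (ptEdges (o + o) Q)) := by
      rw [mem_vertsOf_shift_neg₂, mem_vertsOf_ptEdges]
      have e : o + o - (![0, 1] + o) = o + ![0, -1] := by (refine (site_eq₂ _ _).2 ⟨?_, ?_⟩ <;> simp only [Pi.add_apply, Pi.sub_apply, wc0, wc1] <;> omega)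
      rw [e]; exact hwQ
    refine ⟨false, .B, o, o, shiftEdges (-o) P, shiftEdges (-o) (ptEdges (o + o) Q),
      ⟨corrB_left hFB, hv, isPolygon_shiftEdges_brick hP _⟩,
      ⟨corrB_left (factsB_rot hrowQ hQ1 hQ2 hQ3), hvQ, isPolygon_shiftEdges_brick (isPolygon_ptEdges hQ _) _⟩,
      by simp [offQ], hJ.2.2.2.1, ?_, ?_, ?_, ?_⟩
    · rw [mir, ← n1, hJ.relP_eq h3]
    · rw [mir, ← n2, hJ.relQ_eq h3]
    · rw [mir, shiftEdges_shiftEdges, neg_add_cancel, shiftEdges_zero]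
    · rw [mir, pt_shift_pt₀]
  · -- type C
    obtain ⟨n1, n2⟩ := normalC t P Q
    have hwQ' : t ∈ vertsOf (ptEdges (t + t + ![1, -1]) Q) := by
      rw [mem_vertsOf_ptEdges, show t + t + ![1, -1] - t = t + ![1, -1] by abel]; exact hwQ
    refine ⟨false, .C, t, t + ![1, -1], shiftEdges (-t) P, shiftEdges (-t) (ptEdges (t + t + ![1, -1]) Q),
      ⟨corrC_left hFC, zero_mem_left htP, isPolygon_shiftEdges_brick hP _⟩,
      ⟨corrC_left (factsC_rot hrowQ htQ), zero_mem_left hwQ', isPolygon_shiftEdges_brick (isPolygon_ptEdges hQ _) _⟩,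
      by simp [offQ], hJ.2.2.2.1, ?_, ?_, ?_, ?_⟩
    · rw [mir, ← n1, hJ.relP_eq h3]
    · rw [mir, ← n2, hJ.relQ_eq h3]
    · rw [mir, shiftEdges_shiftEdges, neg_add_cancel, shiftEdges_zero]
    · rw [mir, pt_shift_pt]
  · -- mirrored type B'
    obtain ⟨n1, n2⟩ := normalB' o P Q
    obtain ⟨htP', hwQ', hF', hrowQ', hQ1', hQ2', hQ3', -⟩ := typeB'_flip htP hwQ hFB hrowQ hQ1 hQ2 hQ3 hsep
    set o' := flipY o
    have hv : (![0, 1] : Site 2) ∈ vertsOf (shiftEdges (-o') (fyEdges P)) := by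
      rw [mem_vertsOf_shift_neg₂, add_comm]; exact htP'
    have hvQ : (![0, 1] : Site 2) ∈ vertsOf (shiftEdges (-o') (ptEdges (o' + o') (fyEdges Q))) := by
      rw [mem_vertsOf_shift_neg₂, mem_vertsOf_ptEdges]
      have e : o' + o' - (![0, 1] + o') = o' + ![0, -1] := by (refine (site_eq₂ _ _).2 ⟨?_, ?_⟩ <;> simp only [Pi.add_apply, Pi.sub_apply, wc0, wc1] <;> omega)
      rw [e]; exact hwQ'
    refine ⟨true, .B, o', o', shiftEdges (-o') (fyEdges P), shiftEdges (-o') (ptEdges (o' + o') (fyEdges Q)),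
      ⟨corrB_left hF', hv, isPolygon_shiftEdges_brick (isPolygon_fyEdges hP) _⟩,
      ⟨corrB_left (factsB_rot hrowQ' hQ1' hQ2' hQ3'), hvQ,
        isPolygon_shiftEdges_brick (isPolygon_ptEdges (isPolygon_fyEdges hQ) _) _⟩,
      by simp [offQ], hJ.2.2.2.1, ?_, ?_, ?_, ?_⟩
    · rw [mir, ← n1, hJ.relP_eq h3]
    · rw [mir, ← n2, hJ.relQ_eq h3]
    · rw [mir, shiftEdges_shiftEdges, neg_add_cancel, shiftEdges_zero, fyEdges_fyEdges]
    · rw [mir, pt_shift_pt₀, fyEdges_fyEdges]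
  · -- mirrored type C'
    obtain ⟨n1, n2⟩ := normalC' t P Q
    obtain ⟨htP', hwQ', hF', hrowQ', htQ', -⟩ := typeC'_flip htP hwQ hFC hrowQ htQ hsep
    set t' := flipY t
    have hwQ'' : t' ∈ vertsOf (ptEdges (t' + t' + ![1, -1]) (fyEdges Q)) := by
      rw [mem_vertsOf_ptEdges, show t' + t' + ![1, -1] - t' = t' + ![1, -1] by abel]; exact hwQ'
    refine ⟨true, .C, t', t' + ![1, -1], shiftEdges (-t') (fyEdges P),
      shiftEdges (-t') (ptEdges (t' + t' + ![1, -1]) (fyEdges Q)),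
      ⟨corrC_left hF', zero_mem_left htP', isPolygon_shiftEdges_brick (isPolygon_fyEdges hP) _⟩,
      ⟨corrC_left (factsC_rot hrowQ' htQ'), zero_mem_left hwQ'',
        isPolygon_shiftEdges_brick (isPolygon_ptEdges (isPolygon_fyEdges hQ) _) _⟩,
      by simp [offQ], hJ.2.2.2.1, ?_, ?_, ?_, ?_⟩
    · rw [mir, ← n1, hJ.relP_eq h3]
    · rw [mir, ← n2, hJ.relQ_eq h3]
    · rw [mir, shiftEdges_shiftEdges, neg_add_cancel, shiftEdges_zero, fyEdges_fyEdges]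
    · rw [mir, pt_shift_pt, fyEdges_fyEdges]

/-- **Two pairs with a common join loop are common translates.**  If the same closing walk `ρ` is a join witness for
`(P₁, Q₁)` and for `(P₂, Q₂)` (brick polygons with `N` edges each), then `P₂ = P₁ + z` and `Q₂ = Q₁ + z` for one vector `z`.
[cite: Madras1995LatticeAnimalsExponent, §2 (the join is injective; primary, not held by the lane); Hammond2015SAPJoining, §3.2 p. 10 and §4.4 p. 27, (4.9) (arXiv v5: the join polygon and its junction plaquette determine the two halves)] -/
theorem JoinWitness.translate {P₁ Q₁ P₂ Q₂ : Finset (Sym2 (Site 2))}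
    (hP₁ : IsPolygon brickGraph P₁) (hQ₁ : IsPolygon brickGraph Q₁)
    (hP₂ : IsPolygon brickGraph P₂) (hQ₂ : IsPolygon brickGraph Q₂)
    (h₁ : JoinWitness N P₁ Q₁ ρ) (h₂ : JoinWitness N P₂ Q₂ ρ) :
    ∃ z : Site 2, P₂ = shiftEdges z P₁ ∧ Q₂ = shiftEdges z Q₁ := by
  obtain ⟨m₁, k₁, bP₁, bQ₁, EP₁, EQ₁, gP₁, gQ₁, off₁, hu₁, aP₁, aQ₁, eP₁, eQ₁⟩ := h₁.normalForm hP₁ hQ₁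
  obtain ⟨m₂, k₂, bP₂, bQ₂, EP₂, EQ₂, gP₂, gQ₂, off₂, hu₂, aP₂, aQ₂, eP₂, eQ₂⟩ := h₂.normalForm hP₂ hQ₂
  have hm : m₁ = m₂ := uOf_inj (hu₁.symm.trans hu₂)
  subst hm
  have hfP := mir_inj (aP₁.symm.trans aP₂)
  obtain ⟨hk, hEP⟩ := formP_inj gP₁ gP₂ hfP
  subst hk
  have hEQ : EQ₁ = EQ₂ := formQ_inj gQ₁ gQ₂ (mir_inj (aQ₁.symm.trans aQ₂))
  subst hEP; subst hEQ
  have hdiff : bQ₂ - bQ₁ = bP₂ - bP₁ := by rw [off₁, off₂]; abel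
  cases m₁
  · refine ⟨bP₂ - bP₁, ?_, ?_⟩
    · rw [eP₂, eP₁, mir, mir, shiftEdges_shiftEdges]; congr 1; abel
    · rw [eQ₂, eQ₁, mir, mir, ← hdiff, ← ptEdges_ptEdges', ptEdges_ptEdges]
  · refine ⟨flipY (bP₂ - bP₁), ?_, ?_⟩
    · rw [eP₂, eP₁, mir, mir, ← fyEdges_shiftEdges, shiftEdges_shiftEdges]
      congr 2; abel
    · rw [eQ₂, eQ₁, mir, mir, ← hdiff, ← fyEdges_shiftEdges, ← ptEdges_ptEdges' bQ₂ bQ₁, ptEdges_ptEdges]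

end TriJoin

end Literature.Probability.RandomPlanarGeometry.SAW
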